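import Literature.Computability.MetaComplexity.EFModMulUMask
import HarnessLib

/-!
# Left distributivity of uniform modular multiplication: `(x ⊕ y) ⊗ b = (x ⊗ b) ⊕ (y ⊗ b)`

Layer E/4 (uniform variant). The distributivity KIT `ModMulU.LD.ldT L` on the inputs
`x, y, b, n` (`4L`): the modular adder `MS = x ⊕ y`, the three certified multipliers
`VX = x ⊗ b`, `VY = y ⊗ b`, `VS = R(MS) ⊗ b` (`ModMulU.mulRT`), per stage `t` two interchange kits
(`ModAddU.MFI.mfiT`) — `MF1_t` on `(P_t(VX), P_t(VY), P_t(VX), P_t(VY))` and `MF2_t` on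
`(R(D_t(VX)), R(D_t(VY)), mk_t(VX), mk_t(VY))` — and the final modular adder
`RL = P_L(VX) ⊕ P_L(VY)`. The law (`ModMulU.LD.isBlock_lines`, part B) proves stage by stage
`P_t(VS) ≡ P_t(VX) ⊕ P_t(VY)` and concludes `P_L(VS) ≡ R(RL)`.

This part A: the layout, its well-formedness, the views of an occurrence and their
availability, the inputs of the interchange kits, and the zero block `0 ⊕ 0 ≡ 0`.

## Sources

* H. Vollmer, *Introduction to Circuit Complexity* (Springer 1999), §1.2–1.3.
* J. Krajíček, *Bounded Arithmetic, Propositional Logic, and Complexity Theory* (CUP 1995), §9.2.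
-/

namespace Literature.Computability.MetaComplexity

open _root_.Computability Complexity Complexity.PropForm Netlist Cluster FregeSystem

namespace ModMulU

namespace LD

variable (L : ℕ)

/-! ### The pieces -/

/-- Length of a certified multiplier. [folklore] -/
def RT (L : ℕ) : ℕ := ML L + (3 * L + 2) * (3 * L + 1)
/-- Length of an interchange kit. [folklore] -/
def MF (L : ℕ) : ℕ := 274 * L + 86
/-- Offset of the first interchange kit. [folklore] -/
def o4 (L : ℕ) : ℕ := (6 * L + 2) + 3 * RT L

/-- Gate of `P_t i` in a certified multiplier at offset `oV`. [folklore] -/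
def pP (oV t i : ℕ) : ℕ := if t = 0 then oV else oV + offA L (t - 1) + (5 * L + 2) + i
/-- Gate of `R(D_t) i`. [folklore] -/
def pD (oV t i : ℕ) : ℕ := oV + offD L t + (5 * L + 2) + i
/-- Gate of `mk_t i`. [folklore] -/
def pM (oV t i : ℕ) : ℕ := oV + offM L t + i

/-- Wiring of `MF1_t`: `(P_t(VX), P_t(VY), P_t(VX), P_t(VY), n)`. [folklore] -/
def wMF1 (t : ℕ) (i : ℕ) : ℕ ⊕ ℕ :=
  if i < L then Sum.inr (pP L (6 * L + 2) t i) else if i < 2 * L then Sum.inr (pP L (6 * L + 2 + RT L) t (i - L))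
  else if i < 3 * L then Sum.inr (pP L (6 * L + 2) t (i - 2 * L))
  else if i < 4 * L then Sum.inr (pP L (6 * L + 2 + RT L) t (i - 3 * L)) else Sum.inl (i - L)

/-- Wiring of `MF2_t`: `(R(D_t(VX)), R(D_t(VY)), mk_t(VX), mk_t(VY), n)`. [folklore] -/
def wMF2 (t : ℕ) (i : ℕ) : ℕ ⊕ ℕ :=
  if i < L then Sum.inr (pD L (6 * L + 2) t i) else if i < 2 * L then Sum.inr (pD L (6 * L + 2 + RT L) t (i - L))
  else if i < 3 * L then Sum.inr (pM L (6 * L + 2) t (i - 2 * L))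
  else if i < 4 * L then Sum.inr (pM L (6 * L + 2 + RT L) t (i - 3 * L)) else Sum.inl (i - L)

/-- Wiring of `RL = P_L(VX) ⊕ P_L(VY)`. [folklore] -/
def wRL (i : ℕ) : ℕ ⊕ ℕ :=
  if i < L then Sum.inr (pP L (6 * L + 2) L i) else if i < 2 * L then Sum.inr (pP L (6 * L + 2 + RT L) L (i - L))
  else Sum.inl (L + i)

/-- The pieces: `MS`, `VX`, `VY`, `VS`, then `MF1_t`, `MF2_t` (`t < L`), then `RL`. [cite: Vollmer1999, §1.2] -/
def pieces (L : ℕ) (k : ℕ) : Piece :=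
  if k = 0 then ⟨ModAddU.modAddT L, 3 * L, fun i => if i < 2 * L then Sum.inl i else Sum.inl (L + i)⟩
  else if k = 1 then ⟨mulRT L, 3 * L, fun i => if i < L then Sum.inl i else Sum.inl (L + i)⟩
  else if k = 2 then ⟨mulRT L, 3 * L, fun i => Sum.inl (L + i)⟩
  else if k = 3 then ⟨mulRT L, 3 * L, fun i => if i < L then Sum.inr (5 * L + 2 + i) else Sum.inl (L + i)⟩
  else if k < 4 + 2 * L then
    (if (k - 4) % 2 = 0 then ⟨ModAddU.MFI.mfiT L, 5 * L, wMF1 L ((k - 4) / 2)⟩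
      else ⟨ModAddU.MFI.mfiT L, 5 * L, wMF2 L ((k - 4) / 2)⟩)
  else ⟨ModAddU.modAddT L, 3 * L, wRL L⟩

/-- Closed-form offsets. [folklore] -/
def offF (L : ℕ) (k : ℕ) : ℕ :=
  if k = 0 then 0 else if k = 1 then 6 * L + 2 else if k = 2 then 6 * L + 2 + RT L else if k = 3 then 6 * L + 2 + 2 * RT L
  else if k ≤ 4 + 2 * L then o4 L + (k - 4) * MF L else o4 L + 2 * L * MF L + (6 * L + 2)

/-- **The distributivity kit.** [cite: Vollmer1999, §1.2–1.3] -/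
def ldT (L : ℕ) : Template := layout (pieces L) (5 + 2 * L)

/-- The length of piece `k`. [folklore] -/
theorem length_piece (k : ℕ) : (pieces L k).T.length =
    if k = 0 then 6 * L + 2 else if k ≤ 3 then RT L else if k < 4 + 2 * L then MF L else 6 * L + 2 := by
  unfold pieces
  by_cases h0 : k = 0
  · subst h0; simp
  by_cases h1 : k = 1
  · subst h1; simp [RT, ML]
  by_cases h2 : k = 2
  · subst h2; simp [RT, ML]
  by_cases h3 : k = 3
  · subst h3; simp [RT, ML]
  rw [if_neg h0, if_neg h1, if_neg h2, if_neg h3, if_neg h0, if_neg (show ¬k ≤ 3 by omega)]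
  by_cases h4 : k < 4 + 2 * L
  · rw [if_pos h4, if_pos h4]
    by_cases h5 : (k - 4) % 2 = 0
    · rw [if_pos h5]; simp [MF]
    · rw [if_neg h5]; simp [MF]
  · rw [if_neg h4, if_neg h4]; simp

/-- **The offsets of the pieces are the closed forms.** [folklore] -/
theorem offset_pieces : ∀ k ≤ 5 + 2 * L, offset (pieces L) k = offF L k := by
  intro k hk
  induction k with
  | zero => rfl
  | succ k ih =>
    rw [offset_succ, ih (by omega), length_piece]
    unfold offF
    rcases Nat.lt_or_ge k 4 with h | h
    · have : k = 0 ∨ k = 1 ∨ k = 2 ∨ k = 3 := by omega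
      rcases this with rfl | rfl | rfl | rfl
      · simp
      · simp
      · simp; ring
      · simp only [show (3 : ℕ) ≠ 0 from by decide, show (3 : ℕ) ≠ 1 from by decide, show (3 : ℕ) ≠ 2 from by decide,
          show (3 + 1 : ℕ) ≠ 0 from by decide, show (3 + 1 : ℕ) ≠ 1 from by decide, show (3 + 1 : ℕ) ≠ 2 from by decide,
          show (3 + 1 : ℕ) ≠ 3 from by decide, if_false, if_true, show (3 : ℕ) ≤ 3 from le_rfl,
          show 3 + 1 ≤ 4 + 2 * L from by omega, show 3 + 1 - 4 = 0 from rfl, Nat.zero_mul, Nat.add_zero, o4]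
        ring
    · rw [if_neg (show ¬k = 0 by omega), if_neg (show ¬k ≤ 3 by omega), if_neg (show ¬k + 1 = 0 by omega),
        if_neg (show ¬k + 1 = 1 by omega), if_neg (show ¬k + 1 = 2 by omega), if_neg (show ¬k + 1 = 3 by omega),
        if_neg (show ¬k = 1 by omega), if_neg (show ¬k = 2 by omega), if_neg (show ¬k = 3 by omega)]
      by_cases h4 : k < 4 + 2 * L
      · rw [if_pos (show k ≤ 4 + 2 * L by omega), if_pos h4, if_pos (show k + 1 ≤ 4 + 2 * L by omega),
          show k + 1 - 4 = k - 4 + 1 by omega, if_neg (show ¬k = 0 by omega)]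
        ring
      · have hk' : k = 4 + 2 * L := by omega
        subst hk'
        rw [if_pos (show 4 + 2 * L ≤ 4 + 2 * L from le_rfl), if_neg h4, if_neg (show ¬4 + 2 * L + 1 ≤ 4 + 2 * L by omega),
          show 4 + 2 * L - 4 = 2 * L by omega, if_neg (show ¬4 + 2 * L = 0 by omega)]

/-- Length of the kit. [folklore] -/
theorem length_ldT : (ldT L).length = o4 L + 2 * L * MF L + (6 * L + 2) := by
  rw [ldT, length_layout, offset_pieces L _ le_rfl]; unfold offF
  rw [if_neg (show ¬5 + 2 * L = 0 by omega), if_neg (show ¬5 + 2 * L = 1 by omega), if_neg (show ¬5 + 2 * L = 2 by omega),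
    if_neg (show ¬5 + 2 * L = 3 by omega), if_neg (show ¬5 + 2 * L ≤ 4 + 2 * L by omega)]

/-- A gate of a certified multiplier lies inside it. [folklore] -/
theorem pP_lt {t i oV : ℕ} (ht : t ≤ L) (hi : i < L) : pP L oV t i < oV + RT L := by
  unfold pP RT ML
  split_ifs with h
  · nlinarith
  · obtain ⟨s, rfl⟩ : ∃ s, t = s + 1 := ⟨t - 1, by omega⟩
    rw [Nat.add_sub_cancel, offA, offD]
    have e := Nat.mul_le_mul_right (13 * L + 4) (show s + 1 ≤ L by omega)
    nlinarith

/-- A gate of a certified multiplier lies inside it. [folklore] -/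
theorem pD_lt {t i oV : ℕ} (ht : t < L) (hi : i < L) : pD L oV t i < oV + RT L := by
  unfold pD RT ML offD
  have e := Nat.mul_le_mul_right (13 * L + 4) (show t + 1 ≤ L by omega)
  nlinarith

/-- A gate of a certified multiplier lies inside it. [folklore] -/
theorem pM_lt {t i oV : ℕ} (ht : t < L) (hi : i < L) : pM L oV t i < oV + RT L := by
  unfold pM RT ML offM offD
  have e := Nat.mul_le_mul_right (13 * L + 4) (show t + 1 ≤ L by omega)
  nlinarith

/-- Every piece is well formed and well wired (`4L` inputs). [cite: Vollmer1999, Def. 1.6] -/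
theorem piece_ok : ∀ k < 5 + 2 * L, Piece.OK (pieces L) (4 * L) k := by
  intro k hk
  unfold Piece.OK
  rw [offset_pieces L k (by omega)]
  unfold pieces offF
  rcases Nat.lt_or_ge k 4 with h | h
  · have : k = 0 ∨ k = 1 ∨ k = 2 ∨ k = 3 := by omega
    rcases this with rfl | rfl | rfl | rfl
    · simp only [if_true]
      refine ⟨ModAddU.wf_modAddT L, fun i hi => ?_⟩
      split_ifs <;> exact ⟨fun a ha => (by cases ha; omega), fun g hg => by cases hg⟩
    · simp only [show (1 : ℕ) ≠ 0 from by decide, if_false, if_true]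
      refine ⟨wf_mulRT L, fun i hi => ?_⟩
      split_ifs <;> exact ⟨fun a ha => (by cases ha; omega), fun g hg => by cases hg⟩
    · simp only [show (2 : ℕ) ≠ 0 from by decide, show (2 : ℕ) ≠ 1 from by decide, if_false, if_true]
      exact ⟨wf_mulRT L, fun i hi => ⟨fun a ha => (by cases ha; omega), fun g hg => by cases hg⟩⟩
    · simp only [show (3 : ℕ) ≠ 0 from by decide, show (3 : ℕ) ≠ 1 from by decide, show (3 : ℕ) ≠ 2 from by decide,
        if_false, if_true]
      refine ⟨wf_mulRT L, fun i hi => ?_⟩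
      split_ifs
      · exact ⟨fun a ha => (by cases ha), fun g hg => by cases hg; unfold RT ML; nlinarith⟩
      · exact ⟨fun a ha => (by cases ha; omega), fun g hg => by cases hg⟩
  · rw [if_neg (show ¬k = 0 by omega), if_neg (show ¬k = 1 by omega), if_neg (show ¬k = 2 by omega),
      if_neg (show ¬k = 3 by omega), if_neg (show ¬k = 0 by omega), if_neg (show ¬k = 1 by omega),
      if_neg (show ¬k = 2 by omega), if_neg (show ¬k = 3 by omega)]
    have ho4 : o4 L = 6 * L + 2 + 3 * RT L := rfl
    by_cases h4 : k < 4 + 2 * L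
    · rw [if_pos h4, if_pos (show k ≤ 4 + 2 * L by omega)]
      have ht : (k - 4) / 2 < L := by omega
      have hMF : o4 L ≤ o4 L + (k - 4) * MF L := Nat.le_add_right _ _
      split_ifs with hpar
      · refine ⟨ModAddU.MFI.wf_mfiT L, fun i hi => ?_⟩
        dsimp only at hi ⊢
        unfold wMF1
        split_ifs with h1 h2 h3 h4'
        · exact ⟨fun a ha => (by cases ha), fun g hg => by cases hg; have := pP_lt L (oV := 6 * L + 2) ht.le h1; omega⟩
        · exact ⟨fun a ha => (by cases ha), fun g hg => by
            cases hg; have := pP_lt L (oV := 6 * L + 2 + RT L) ht.le (show i - L < L by omega); omega⟩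
        · exact ⟨fun a ha => (by cases ha), fun g hg => by
            cases hg; have := pP_lt L (oV := 6 * L + 2) ht.le (show i - 2 * L < L by omega); omega⟩
        · exact ⟨fun a ha => (by cases ha), fun g hg => by
            cases hg; have := pP_lt L (oV := 6 * L + 2 + RT L) ht.le (show i - 3 * L < L by omega); omega⟩
        · exact ⟨fun a ha => (by cases ha; omega), fun g hg => by cases hg⟩
      · refine ⟨ModAddU.MFI.wf_mfiT L, fun i hi => ?_⟩
        dsimp only at hi ⊢
        unfold wMF2
        split_ifs with h1 h2 h3 h4'
        · exact ⟨fun a ha => (by cases ha), fun g hg => by cases hg; have := pD_lt L (oV := 6 * L + 2) ht h1; omega⟩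
        · exact ⟨fun a ha => (by cases ha), fun g hg => by
            cases hg; have := pD_lt L (oV := 6 * L + 2 + RT L) ht (show i - L < L by omega); omega⟩
        · exact ⟨fun a ha => (by cases ha), fun g hg => by
            cases hg; have := pM_lt L (oV := 6 * L + 2) ht (show i - 2 * L < L by omega); omega⟩
        · exact ⟨fun a ha => (by cases ha), fun g hg => by
            cases hg; have := pM_lt L (oV := 6 * L + 2 + RT L) ht (show i - 3 * L < L by omega); omega⟩
        · exact ⟨fun a ha => (by cases ha; omega), fun g hg => by cases hg⟩
    · rw [if_neg h4, if_pos (show k ≤ 4 + 2 * L by omega)]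
      refine ⟨ModAddU.wf_modAddT L, fun i hi => ?_⟩
      have hMF : o4 L ≤ o4 L + (k - 4) * MF L := Nat.le_add_right _ _
      dsimp only at hi ⊢
      unfold wRL
      split_ifs with h1 h2
      · exact ⟨fun a ha => (by cases ha), fun g hg => by cases hg; have := pP_lt L (oV := 6 * L + 2) le_rfl h1; omega⟩
      · exact ⟨fun a ha => (by cases ha), fun g hg => by
          cases hg; have := pP_lt L (oV := 6 * L + 2 + RT L) le_rfl (show i - L < L by omega); omega⟩
      · exact ⟨fun a ha => (by cases ha; omega), fun g hg => by cases hg⟩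

/-- **The distributivity kit is well formed** (`4L` inputs). [cite: Vollmer1999, Def. 1.6] -/
theorem wf_ldT : (ldT L).WF (4 * L) := wf_layout (pieces L) (piece_ok L)

/-! ### Unfolding the stage pieces -/

/-- Piece `4 + 2t` is `MF1_t`. [folklore] -/
theorem pieces_MF1 {t : ℕ} (ht : t < L) : pieces L (4 + 2 * t) = ⟨ModAddU.MFI.mfiT L, 5 * L, wMF1 L t⟩ := by
  unfold pieces
  rw [if_neg (show ¬4 + 2 * t = 0 by omega), if_neg (show ¬4 + 2 * t = 1 by omega), if_neg (show ¬4 + 2 * t = 2 by omega),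
    if_neg (show ¬4 + 2 * t = 3 by omega), if_pos (show 4 + 2 * t < 4 + 2 * L by omega),
    if_pos (show (4 + 2 * t - 4) % 2 = 0 by omega), show (4 + 2 * t - 4) / 2 = t by omega]

/-- Piece `5 + 2t` is `MF2_t`. [folklore] -/
theorem pieces_MF2 {t : ℕ} (ht : t < L) : pieces L (5 + 2 * t) = ⟨ModAddU.MFI.mfiT L, 5 * L, wMF2 L t⟩ := by
  unfold pieces
  rw [if_neg (show ¬5 + 2 * t = 0 by omega), if_neg (show ¬5 + 2 * t = 1 by omega), if_neg (show ¬5 + 2 * t = 2 by omega),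
    if_neg (show ¬5 + 2 * t = 3 by omega), if_pos (show 5 + 2 * t < 4 + 2 * L by omega),
    if_neg (show ¬(5 + 2 * t - 4) % 2 = 0 by omega), show (5 + 2 * t - 4) / 2 = t by omega]

/-- Piece `4 + 2L` is `RL`. [folklore] -/
theorem pieces_RL : pieces L (4 + 2 * L) = ⟨ModAddU.modAddT L, 3 * L, wRL L⟩ := by
  unfold pieces
  rw [if_neg (show ¬4 + 2 * L = 0 by omega), if_neg (show ¬4 + 2 * L = 1 by omega), if_neg (show ¬4 + 2 * L = 2 by omega),
    if_neg (show ¬4 + 2 * L = 3 by omega), if_neg (show ¬4 + 2 * L < 4 + 2 * L by omega)]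

/-! ### The views of an occurrence -/

section Views

variable (o : Occ)

/-- Operand `x`. [folklore] -/
def x (i : ℕ) : ℕ := o.inp i
/-- Operand `y`. [folklore] -/
def y (i : ℕ) : ℕ := o.inp (L + i)
/-- The multiplier word `b`. [folklore] -/
def bw (i : ℕ) : ℕ := o.inp (2 * L + i)
/-- The modulus. [folklore] -/
def n (i : ℕ) : ℕ := o.inp (3 * L + i)
/-- `MS = x ⊕ y`. [folklore] -/
def MS : ModAddU.View := ⟨o.base, x o, y L o, n L o⟩
/-- `VX = x ⊗ b` (certified). [folklore] -/
def VX : View := ⟨o.base + (6 * L + 2), x o, bw L o, n L o⟩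
/-- `VY = y ⊗ b` (certified). [folklore] -/
def VY : View := ⟨o.base + (6 * L + 2 + RT L), y L o, bw L o, n L o⟩
/-- `VS = R(MS) ⊗ b` (certified). [folklore] -/
def VS : View := ⟨o.base + (6 * L + 2 + 2 * RT L), (MS L o).R L, bw L o, n L o⟩
/-- The occurrence of `MF1_t`. [folklore] -/
def MF1 (t : ℕ) : Occ := pieceOcc (o.inst (4 * L)) (pieces L) (4 + 2 * t)
/-- The occurrence of `MF2_t`. [folklore] -/
def MF2 (t : ℕ) : Occ := pieceOcc (o.inst (4 * L)) (pieces L) (5 + 2 * t)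
/-- `RL = P_L(VX) ⊕ P_L(VY)`. [folklore] -/
def RL : ModAddU.View := ⟨o.base + (o4 L + 2 * L * MF L), (VX L o).P L L, (VY L o).P L L, n L o⟩

/-- All pieces of the distributivity kit are available. [folklore] -/
structure LAvail (K : PropForm ℕ) (Γ : Set (PropForm ℕ)) : Prop where
  /-- `MS` -/
  hMS : (MS L o).Avail K Γ L
  /-- `VX` -/
  hVX : (VX L o).RAvail L K Γ
  /-- `VY` -/
  hVY : (VY L o).RAvail L K Γ
  /-- `VS` -/
  hVS : (VS L o).RAvail L K Γ
  /-- `MF1_t` -/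
  hMF1 : ∀ t < L, (MF1 L o t).Avail (ModAddU.MFI.mfiT L) (5 * L) K Γ
  /-- `MF2_t` -/
  hMF2 : ∀ t < L, (MF2 L o t).Avail (ModAddU.MFI.mfiT L) (5 * L) K Γ
  /-- `RL` -/
  hRL : (RL L o).Avail K Γ L

end Views

variable {L} {o : Occ} {K : PropForm ℕ} {Γ : Set (PropForm ℕ)}

/-- Availability of a certified multiplier view transfers along pointwise equal operands. [folklore] -/
theorem _root_.Literature.Computability.MetaComplexity.ModMulU.View.RAvail.congr {V V' : View} {L : ℕ} {K : PropForm ℕ}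
    {Γ : Set (PropForm ℕ)} (h : V.RAvail L K Γ) (hb0 : V'.base = V.base) (ha : ∀ i < L, V'.a i = V.a i)
    (hb : ∀ i < L, V'.b i = V.b i) (hn : ∀ i < L, V'.n i = V.n i) : V'.RAvail L K Γ := by
  obtain ⟨base, a, b, n⟩ := V
  obtain ⟨base', a', b', n'⟩ := V'
  simp only at hb0 ha hb hn
  subst hb0
  exact ⟨h.hV.congr rfl ha hb hn, h.hCA.congr rfl ha hn, h.hCZ.congr rfl (fun i _ => rfl) hn,
    fun s hs => (h.hCD s hs).congr rfl (fun i _ => rfl) hn, fun s hs => (h.hCM s hs).congr rfl (fun i _ => rfl) hn,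
    fun s hs => (h.hCPp s hs).congr rfl (fun i _ => rfl) hn⟩

/-- The base of the occurrence of piece `k`. [folklore] -/
theorem base_q {k : ℕ} (hk : k ≤ 5 + 2 * L) : (pieceOcc (o.inst (4 * L)) (pieces L) k).base = o.base + offF L k := by
  simp [pieceOcc, offset_pieces L k hk]

/-- An input of a piece wired to a kit input. [folklore] -/
theorem inp_q_inl {k i j : ℕ} (hw : (pieces L k).wire i = Sum.inl j) (hj : j < 4 * L) :
    (pieceOcc (o.inst (4 * L)) (pieces L) k).inp i = o.inp j := by
  rw [inp_pieceOcc, hw, Occ.ref_inl o hj]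

/-- An input of a piece wired to an earlier gate. [folklore] -/
theorem inp_q_inr {k i g : ℕ} (hw : (pieces L k).wire i = Sum.inr g) :
    (pieceOcc (o.inst (4 * L)) (pieces L) k).inp i = o.base + g := by
  rw [inp_pieceOcc, hw, Occ.ref_inr]; rfl

/-- Pieces `0 … 3`, unfolded. [folklore] -/
theorem pieces_0123 : pieces L 0 = ⟨ModAddU.modAddT L, 3 * L, fun i => if i < 2 * L then Sum.inl i else Sum.inl (L + i)⟩ ∧
    pieces L 1 = ⟨mulRT L, 3 * L, fun i => if i < L then Sum.inl i else Sum.inl (L + i)⟩ ∧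
    pieces L 2 = ⟨mulRT L, 3 * L, fun i => Sum.inl (L + i)⟩ ∧
    pieces L 3 = ⟨mulRT L, 3 * L, fun i => if i < L then Sum.inr (5 * L + 2 + i) else Sum.inl (L + i)⟩ :=
  ⟨rfl, rfl, rfl, rfl⟩

/-- The gate of `P_t i` resolves to the view. [folklore] -/
theorem pP_eq (oV t i : ℕ) : o.base + pP L oV t i = (⟨o.base + oV, x o, bw L o, n L o⟩ : View).P L t i := by
  unfold pP View.P
  split_ifs <;> simp [Nat.add_assoc]

/-- The gate of `P_t i` resolves to the view `VY`. [folklore] -/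
theorem pP_eq' (oV t i : ℕ) (a b : ℕ → ℕ) : o.base + pP L oV t i = (⟨o.base + oV, a, b, n L o⟩ : View).P L t i := by
  unfold pP View.P
  split_ifs <;> simp [Nat.add_assoc]

/-- Availability of `MS`. [folklore] -/
theorem avail_MS (ho : o.Avail (ldT L) (4 * L) K Γ) : (MS L o).Avail K Γ L := by
  have hq : (pieceOcc (o.inst (4 * L)) (pieces L) 0).Avail (ModAddU.modAddT L) (3 * L) K Γ := by
    have := Inst.DefsAvail.piece ho (k := 0) (by omega) (by rw [pieces_0123.1]; exact ModAddU.wf_modAddT L)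
    rw [pieces_0123.1] at this; exact this
  refine ModAddU.View.Avail.congr (ModAddU.avail_viewOf hq) ?_ (fun i hi => ?_) (fun i hi => ?_) (fun i hi => ?_)
  · show o.base = (pieceOcc (o.inst (4 * L)) (pieces L) 0).base; rw [base_q (by omega)]; rfl
  · show o.inp i = ((pieceOcc (o.inst (4 * L)) (pieces L) 0).inst (3 * L)).inputs.getD i 0
    rw [Occ.getD_inst _ (show i < 3 * L by omega), inp_q_inl (k := 0) (i := i) (j := i)
      (by rw [pieces_0123.1]; dsimp only; rw [if_pos (show i < 2 * L by omega)]) (by omega)]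
  · show o.inp (L + i) = ((pieceOcc (o.inst (4 * L)) (pieces L) 0).inst (3 * L)).inputs.getD (L + i) 0
    rw [Occ.getD_inst _ (show L + i < 3 * L by omega), inp_q_inl (k := 0) (i := L + i) (j := L + i)
      (by rw [pieces_0123.1]; dsimp only; rw [if_pos (show L + i < 2 * L by omega)]) (by omega)]
  · show o.inp (3 * L + i) = ((pieceOcc (o.inst (4 * L)) (pieces L) 0).inst (3 * L)).inputs.getD (2 * L + i) 0
    rw [Occ.getD_inst _ (show 2 * L + i < 3 * L by omega), inp_q_inl (k := 0) (i := 2 * L + i) (j := 3 * L + i)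
      (by rw [pieces_0123.1]; dsimp only; rw [if_neg (show ¬2 * L + i < 2 * L by omega)]; congr 1; omega) (by omega)]

/-- Availability of a certified multiplier piece `k ∈ {1, 2, 3}`. [folklore] -/
theorem ravail_q {k : ℕ} (ho : o.Avail (ldT L) (4 * L) K Γ) (hp : (pieces L k).T = mulRT L ∧ (pieces L k).nIn = 3 * L)
    (hk : k < 5 + 2 * L) : (viewOf (pieceOcc (o.inst (4 * L)) (pieces L) k) L).RAvail L K Γ := by
  have hq : (pieceOcc (o.inst (4 * L)) (pieces L) k).Avail (mulRT L) (3 * L) K Γ := by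
    have := Inst.DefsAvail.piece ho (k := k) hk (by rw [hp.1, hp.2]; exact wf_mulRT L)
    rw [hp.1, hp.2] at this; exact this
  exact ravail_ofOcc hq

/-- Availability of `VX`. [folklore] -/
theorem avail_VX (ho : o.Avail (ldT L) (4 * L) K Γ) : (VX L o).RAvail L K Γ := by
  refine (ravail_q ho (k := 1) (by rw [pieces_0123.2.1]; exact ⟨rfl, rfl⟩) (by omega)).congr ?_ (fun i hi => ?_)
    (fun i hi => ?_) (fun i hi => ?_)
  · show o.base + (6 * L + 2) = (pieceOcc (o.inst (4 * L)) (pieces L) 1).base; rw [base_q (by omega)]; rfl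
  · show o.inp i = (pieceOcc (o.inst (4 * L)) (pieces L) 1).inp i
    rw [inp_q_inl (k := 1) (i := i) (j := i) (by rw [pieces_0123.2.1]; dsimp only; rw [if_pos hi]) (by omega)]
  · show o.inp (2 * L + i) = (pieceOcc (o.inst (4 * L)) (pieces L) 1).inp (L + i)
    rw [inp_q_inl (k := 1) (i := L + i) (j := 2 * L + i)
      (by rw [pieces_0123.2.1]; dsimp only; rw [if_neg (show ¬L + i < L by omega)]; congr 1; omega) (by omega)]
  · show o.inp (3 * L + i) = (pieceOcc (o.inst (4 * L)) (pieces L) 1).inp (2 * L + i)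
    rw [inp_q_inl (k := 1) (i := 2 * L + i) (j := 3 * L + i)
      (by rw [pieces_0123.2.1]; dsimp only; rw [if_neg (show ¬2 * L + i < L by omega)]; congr 1; omega) (by omega)]

/-- Availability of `VY`. [folklore] -/
theorem avail_VY (ho : o.Avail (ldT L) (4 * L) K Γ) : (VY L o).RAvail L K Γ := by
  refine (ravail_q ho (k := 2) (by rw [pieces_0123.2.2.1]; exact ⟨rfl, rfl⟩) (by omega)).congr ?_ (fun i hi => ?_)
    (fun i hi => ?_) (fun i hi => ?_)
  · show o.base + (6 * L + 2 + RT L) = (pieceOcc (o.inst (4 * L)) (pieces L) 2).base; rw [base_q (by omega)]; rfl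
  · show o.inp (L + i) = (pieceOcc (o.inst (4 * L)) (pieces L) 2).inp i
    rw [inp_q_inl (k := 2) (i := i) (j := L + i) (by rw [pieces_0123.2.2.1]) (by omega)]
  · show o.inp (2 * L + i) = (pieceOcc (o.inst (4 * L)) (pieces L) 2).inp (L + i)
    rw [inp_q_inl (k := 2) (i := L + i) (j := 2 * L + i) (by rw [pieces_0123.2.2.1]; dsimp only; congr 1; omega) (by omega)]
  · show o.inp (3 * L + i) = (pieceOcc (o.inst (4 * L)) (pieces L) 2).inp (2 * L + i)
    rw [inp_q_inl (k := 2) (i := 2 * L + i) (j := 3 * L + i) (by rw [pieces_0123.2.2.1]; dsimp only; congr 1; omega)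
      (by omega)]

/-- Availability of `VS`. [folklore] -/
theorem avail_VS (ho : o.Avail (ldT L) (4 * L) K Γ) : (VS L o).RAvail L K Γ := by
  refine (ravail_q ho (k := 3) (by rw [pieces_0123.2.2.2]; exact ⟨rfl, rfl⟩) (by omega)).congr ?_ (fun i hi => ?_)
    (fun i hi => ?_) (fun i hi => ?_)
  · show o.base + (6 * L + 2 + 2 * RT L) = (pieceOcc (o.inst (4 * L)) (pieces L) 3).base; rw [base_q (by omega)]; rfl
  · show o.base + (5 * L + 2) + i = (pieceOcc (o.inst (4 * L)) (pieces L) 3).inp i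
    rw [inp_q_inr (k := 3) (i := i) (g := 5 * L + 2 + i) (by rw [pieces_0123.2.2.2]; dsimp only; rw [if_pos hi])]; omega
  · show o.inp (2 * L + i) = (pieceOcc (o.inst (4 * L)) (pieces L) 3).inp (L + i)
    rw [inp_q_inl (k := 3) (i := L + i) (j := 2 * L + i)
      (by rw [pieces_0123.2.2.2]; dsimp only; rw [if_neg (show ¬L + i < L by omega)]; congr 1; omega) (by omega)]
  · show o.inp (3 * L + i) = (pieceOcc (o.inst (4 * L)) (pieces L) 3).inp (2 * L + i)
    rw [inp_q_inl (k := 3) (i := 2 * L + i) (j := 3 * L + i)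
      (by rw [pieces_0123.2.2.2]; dsimp only; rw [if_neg (show ¬2 * L + i < L by omega)]; congr 1; omega) (by omega)]

/-- Availability of the interchange kits. [folklore] -/
theorem avail_MF (ho : o.Avail (ldT L) (4 * L) K Γ) {t : ℕ} (ht : t < L) :
    (MF1 L o t).Avail (ModAddU.MFI.mfiT L) (5 * L) K Γ ∧ (MF2 L o t).Avail (ModAddU.MFI.mfiT L) (5 * L) K Γ := by
  constructor
  · have := Inst.DefsAvail.piece ho (k := 4 + 2 * t) (by omega) (by rw [pieces_MF1 L ht]; exact ModAddU.MFI.wf_mfiT L)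
    rw [pieces_MF1 L ht] at this; exact this
  · have := Inst.DefsAvail.piece ho (k := 5 + 2 * t) (by omega) (by rw [pieces_MF2 L ht]; exact ModAddU.MFI.wf_mfiT L)
    rw [pieces_MF2 L ht] at this; exact this

/-- Availability of `RL`. [folklore] -/
theorem avail_RL (ho : o.Avail (ldT L) (4 * L) K Γ) : (RL L o).Avail K Γ L := by
  have hq : (pieceOcc (o.inst (4 * L)) (pieces L) (4 + 2 * L)).Avail (ModAddU.modAddT L) (3 * L) K Γ := by
    have := Inst.DefsAvail.piece ho (k := 4 + 2 * L) (by omega) (by rw [pieces_RL]; exact ModAddU.wf_modAddT L)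
    rw [pieces_RL] at this; exact this
  refine ModAddU.View.Avail.congr (ModAddU.avail_viewOf hq) ?_ (fun i hi => ?_) (fun i hi => ?_) (fun i hi => ?_)
  · show o.base + (o4 L + 2 * L * MF L) = (pieceOcc (o.inst (4 * L)) (pieces L) (4 + 2 * L)).base
    rw [base_q (by omega)]; unfold offF
    rw [if_neg (show ¬4 + 2 * L = 0 by omega), if_neg (show ¬4 + 2 * L = 1 by omega), if_neg (show ¬4 + 2 * L = 2 by omega),
      if_neg (show ¬4 + 2 * L = 3 by omega), if_pos (show 4 + 2 * L ≤ 4 + 2 * L from le_rfl), show 4 + 2 * L - 4 = 2 * L by omega]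
  · show (VX L o).P L L i = ((pieceOcc (o.inst (4 * L)) (pieces L) (4 + 2 * L)).inst (3 * L)).inputs.getD i 0
    rw [Occ.getD_inst _ (show i < 3 * L by omega), inp_q_inr (k := 4 + 2 * L) (i := i) (g := pP L (6 * L + 2) L i)
      (by rw [pieces_RL]; dsimp only; unfold wRL; rw [if_pos hi]), pP_eq]; rfl
  · show (VY L o).P L L i = ((pieceOcc (o.inst (4 * L)) (pieces L) (4 + 2 * L)).inst (3 * L)).inputs.getD (L + i) 0
    rw [Occ.getD_inst _ (show L + i < 3 * L by omega), inp_q_inr (k := 4 + 2 * L) (i := L + i) (g := pP L (6 * L + 2 + RT L) L i)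
      (by rw [pieces_RL]; dsimp only; unfold wRL; rw [if_neg (show ¬L + i < L by omega), if_pos (show L + i < 2 * L by omega),
        Nat.add_sub_cancel_left]), pP_eq' _ _ _ (y L o) (bw L o)]; rfl
  · show o.inp (3 * L + i) = ((pieceOcc (o.inst (4 * L)) (pieces L) (4 + 2 * L)).inst (3 * L)).inputs.getD (2 * L + i) 0
    rw [Occ.getD_inst _ (show 2 * L + i < 3 * L by omega), inp_q_inl (k := 4 + 2 * L) (i := 2 * L + i) (j := 3 * L + i)
      (by rw [pieces_RL]; dsimp only; unfold wRL; rw [if_neg (show ¬2 * L + i < L by omega),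
        if_neg (show ¬2 * L + i < 2 * L by omega)]; congr 1; omega) (by omega)]

/-- **All pieces of an available occurrence of the distributivity kit are available.** [folklore] -/
theorem avail_ofOcc (ho : o.Avail (ldT L) (4 * L) K Γ) : LAvail L o K Γ :=
  ⟨avail_MS ho, avail_VX ho, avail_VY ho, avail_VS ho, fun _ ht => (avail_MF ho ht).1, fun _ ht => (avail_MF ho ht).2, avail_RL ho⟩

/-! ### The inputs of the interchange kits -/

/-- The inputs of `MF1_t`: `(P_t(VX), P_t(VY), P_t(VX), P_t(VY), n)`. [folklore] -/
theorem MF1_inp {t i : ℕ} (ht : t < L) (hi : i < L) :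
    (MF1 L o t).inp i = (VX L o).P L t i ∧ (MF1 L o t).inp (L + i) = (VY L o).P L t i ∧
      (MF1 L o t).inp (2 * L + i) = (VX L o).P L t i ∧ (MF1 L o t).inp (3 * L + i) = (VY L o).P L t i ∧
      (MF1 L o t).inp (4 * L + i) = o.inp (3 * L + i) := by
  refine ⟨?_, ?_, ?_, ?_, ?_⟩
  · rw [show MF1 L o t = pieceOcc (o.inst (4 * L)) (pieces L) (4 + 2 * t) from rfl,
      inp_q_inr (k := 4 + 2 * t) (i := i) (g := pP L (6 * L + 2) t i)
      (by rw [pieces_MF1 L ht]; dsimp only; unfold wMF1; rw [if_pos hi]), pP_eq]; rfl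
  · rw [show MF1 L o t = pieceOcc (o.inst (4 * L)) (pieces L) (4 + 2 * t) from rfl,
      inp_q_inr (k := 4 + 2 * t) (i := L + i) (g := pP L (6 * L + 2 + RT L) t i)
      (by rw [pieces_MF1 L ht]; dsimp only; unfold wMF1; rw [if_neg (show ¬L + i < L by omega),
        if_pos (show L + i < 2 * L by omega), Nat.add_sub_cancel_left]), pP_eq' _ _ _ (y L o) (bw L o)]; rfl
  · rw [show MF1 L o t = pieceOcc (o.inst (4 * L)) (pieces L) (4 + 2 * t) from rfl,
      inp_q_inr (k := 4 + 2 * t) (i := 2 * L + i) (g := pP L (6 * L + 2) t i)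
      (by rw [pieces_MF1 L ht]; dsimp only; unfold wMF1; rw [if_neg (show ¬2 * L + i < L by omega),
        if_neg (show ¬2 * L + i < 2 * L by omega), if_pos (show 2 * L + i < 3 * L by omega),
        show 2 * L + i - 2 * L = i by omega]), pP_eq]; rfl
  · rw [show MF1 L o t = pieceOcc (o.inst (4 * L)) (pieces L) (4 + 2 * t) from rfl,
      inp_q_inr (k := 4 + 2 * t) (i := 3 * L + i) (g := pP L (6 * L + 2 + RT L) t i)
      (by rw [pieces_MF1 L ht]; dsimp only; unfold wMF1; rw [if_neg (show ¬3 * L + i < L by omega),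
        if_neg (show ¬3 * L + i < 2 * L by omega), if_neg (show ¬3 * L + i < 3 * L by omega),
        if_pos (show 3 * L + i < 4 * L by omega), show 3 * L + i - 3 * L = i by omega]), pP_eq' _ _ _ (y L o) (bw L o)]; rfl
  · rw [show MF1 L o t = pieceOcc (o.inst (4 * L)) (pieces L) (4 + 2 * t) from rfl,
      inp_q_inl (k := 4 + 2 * t) (i := 4 * L + i) (j := 3 * L + i)
      (by rw [pieces_MF1 L ht]; dsimp only; unfold wMF1; rw [if_neg (show ¬4 * L + i < L by omega),
        if_neg (show ¬4 * L + i < 2 * L by omega), if_neg (show ¬4 * L + i < 3 * L by omega),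
        if_neg (show ¬4 * L + i < 4 * L by omega)]; congr 1; omega) (by omega)]

/-- The inputs of `MF2_t`: `(R(D_t(VX)), R(D_t(VY)), mk_t(VX), mk_t(VY), n)`. [folklore] -/
theorem MF2_inp {t i : ℕ} (ht : t < L) (hi : i < L) :
    (MF2 L o t).inp i = ((VX L o).Dv L t).R L i ∧ (MF2 L o t).inp (L + i) = ((VY L o).Dv L t).R L i ∧
      (MF2 L o t).inp (2 * L + i) = (VX L o).msk L t i ∧ (MF2 L o t).inp (3 * L + i) = (VY L o).msk L t i ∧
      (MF2 L o t).inp (4 * L + i) = o.inp (3 * L + i) := by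
  refine ⟨?_, ?_, ?_, ?_, ?_⟩
  · rw [show MF2 L o t = pieceOcc (o.inst (4 * L)) (pieces L) (5 + 2 * t) from rfl,
      inp_q_inr (k := 5 + 2 * t) (i := i) (g := pD L (6 * L + 2) t i)
      (by rw [pieces_MF2 L ht]; dsimp only; unfold wMF2; rw [if_pos hi])]
    simp [pD, VX, View.Dv, ModAddU.View.R, Nat.add_assoc]
  · rw [show MF2 L o t = pieceOcc (o.inst (4 * L)) (pieces L) (5 + 2 * t) from rfl,
      inp_q_inr (k := 5 + 2 * t) (i := L + i) (g := pD L (6 * L + 2 + RT L) t i)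
      (by rw [pieces_MF2 L ht]; dsimp only; unfold wMF2; rw [if_neg (show ¬L + i < L by omega),
        if_pos (show L + i < 2 * L by omega), Nat.add_sub_cancel_left])]
    simp [pD, VY, View.Dv, ModAddU.View.R, Nat.add_assoc]
  · rw [show MF2 L o t = pieceOcc (o.inst (4 * L)) (pieces L) (5 + 2 * t) from rfl,
      inp_q_inr (k := 5 + 2 * t) (i := 2 * L + i) (g := pM L (6 * L + 2) t i)
      (by rw [pieces_MF2 L ht]; dsimp only; unfold wMF2; rw [if_neg (show ¬2 * L + i < L by omega),
        if_neg (show ¬2 * L + i < 2 * L by omega), if_pos (show 2 * L + i < 3 * L by omega),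
        show 2 * L + i - 2 * L = i by omega])]
    simp [pM, VX, View.msk, Nat.add_assoc]
  · rw [show MF2 L o t = pieceOcc (o.inst (4 * L)) (pieces L) (5 + 2 * t) from rfl,
      inp_q_inr (k := 5 + 2 * t) (i := 3 * L + i) (g := pM L (6 * L + 2 + RT L) t i)
      (by rw [pieces_MF2 L ht]; dsimp only; unfold wMF2; rw [if_neg (show ¬3 * L + i < L by omega),
        if_neg (show ¬3 * L + i < 2 * L by omega), if_neg (show ¬3 * L + i < 3 * L by omega),
        if_pos (show 3 * L + i < 4 * L by omega), show 3 * L + i - 3 * L = i by omega])]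
    simp [pM, VY, View.msk, Nat.add_assoc]
  · rw [show MF2 L o t = pieceOcc (o.inst (4 * L)) (pieces L) (5 + 2 * t) from rfl,
      inp_q_inl (k := 5 + 2 * t) (i := 4 * L + i) (j := 3 * L + i)
      (by rw [pieces_MF2 L ht]; dsimp only; unfold wMF2; rw [if_neg (show ¬4 * L + i < L by omega),
        if_neg (show ¬4 * L + i < 2 * L by omega), if_neg (show ¬4 * L + i < 3 * L by omega),
        if_neg (show ¬4 * L + i < 4 * L by omega)]; congr 1; omega) (by omega)]

/-! ### The zero block: `0 ⊕ 0 ≡ 0` -/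

/-- The data of the zero block: a modular adder `MM = za ⊕ zb` on bitwise false words, a
comparator `CA = (xa, nw)` answering `<`, and a bitwise false word `w`. [folklore] -/
structure ZeroData where
  /-- the width -/
  L : ℕ
  /-- base of `MM` -/
  bMM : ℕ
  /-- first operand (false) -/
  za : ℕ → ℕ
  /-- second operand (false) -/
  zb : ℕ → ℕ
  /-- the modulus word -/
  nw : ℕ → ℕ
  /-- base of the comparator -/
  bCA : ℕ
  /-- the compared word -/
  xa : ℕ → ℕ
  /-- the target word (false) -/
  w : ℕ → ℕ

namespace ZeroData

variable (d : ZeroData)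

/-- `MM = za ⊕ zb`. [folklore] -/
def MM : ModAddU.View := ⟨d.bMM, d.za, d.zb, d.nw⟩
/-- The comparator. [folklore] -/
def CA : Sub.View := ⟨d.bCA, d.xa, d.nw⟩

/-- Leaf assignment of `ZADDF`. [folklore] -/
def act (i : ℕ) (k : ℕ) : ℕ :=
  [0, d.MM.S.c i, d.MM.Dc d.L i, d.CA.ge d.L i, d.za i, d.zb i, d.nw i, d.xa i, d.MM.S.s i, d.MM.S.c (i + 1),
    (d.MM.D d.L).ny i, d.MM.Dc d.L (i + 1), d.CA.ny i, d.CA.ge d.L (i + 1)].getD k 0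

/-- The segments of the zero block. [folklore] -/
def segs (K : PropForm ℕ) : List (List (PropForm ℕ)) :=
  [ZADDF.lines K d.act d.L,
   (List.range d.L).map (fun i => ctx K (inst (d.act i) (neg (var 8)))),
   [ctx K (inst (d.act d.L) (neg (var 2)))],
   (List.range d.L).map (fun i => ctx K (neg (var (d.MM.R d.L i)))),
   (List.range d.L).map (fun i => ctx K (eqv (d.w i) (d.MM.R d.L i)))]

variable {G : FregeSystem} {K : PropForm ℕ}

/-- Availability of the shapes of `ZADDF`. [folklore] -/
theorem avail_act {T : Set (PropForm ℕ)} (hMM : d.MM.Avail K T d.L) (hCA : d.CA.Avail K T d.L)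
    (hx : ∀ i < d.L, ctx K (neg (var (d.za i))) ∈ T) (hy : ∀ i < d.L, ctx K (neg (var (d.zb i))) ∈ T) :
    ∀ i < d.L, ∀ φ ∈ ZADDF.shapes, ctx K (inst (d.act i) φ) ∈ T := by
  intro i hi φ hφ
  simp only [ZADDF, List.mem_cons, List.not_mem_nil, or_false] at hφ
  rcases hφ with rfl | rfl | rfl | rfl | rfl | rfl | rfl | rfl
  exacts [(hMM.1.2 i hi).1, (hMM.1.2 i hi).2, hMM.2.1.1 i hi, (hMM.2.1.2.2 i hi).2, hCA.1 i hi, (hCA.2.2 i hi).2, hx i hi, hy i hi]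

/-- **The zero block**: the modular sum of two bitwise false words has bitwise false output, so
it equals the bitwise false word `w`. [cite: CookReckhow1979, §2] -/
theorem isBlock_segs (hGK : ∀ r ∈ maskRules, r ∈ G.rules) (hGL : ∀ r ∈ Logic.rules, r ∈ G.rules) {T : Set (PropForm ℕ)}
    (hMM : d.MM.Avail K T d.L) (hCA : d.CA.Avail K T d.L) (hza : ∀ i < d.L, ctx K (neg (var (d.za i))) ∈ T)
    (hzb : ∀ i < d.L, ctx K (neg (var (d.zb i))) ∈ T) (hw : ∀ i < d.L, ctx K (neg (var (d.w i))) ∈ T)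
    (hlt : ctx K (neg (var (d.CA.ge d.L d.L))) ∈ T) : G.IsBlock T (d.segs K).flatten := by
  refine ModAddU.AssocData.isBlock_flatten _ fun k hk => ?_
  simp only [segs, List.length_cons, List.length_nil] at hk
  have mem : ∀ {χ} (j : ℕ) (hj : j < k) (hχ : χ ∈ (d.segs K)[j]'(by simp [segs]; omega)),
      χ ∈ T ∪ {χ | ∃ j, ∃ hj : j < k, χ ∈ (d.segs K)[j]'(by simp [segs]; omega)} := fun j hj hχ => Or.inr ⟨j, hj, hχ⟩
  have hΓ : T ⊆ T ∪ {χ | ∃ j, ∃ hj : j < k, χ ∈ (d.segs K)[j]'(by simp [segs]; omega)} := fun _ hχ => Or.inl hχ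
  interval_cases k
  · exact System.isBlock_lines zaddfLeavesOK (hGK _ (mem_maskRules (i := 0) (by decide)))
      (hGK _ (mem_maskRules (i := 1) (by decide))) K d.act d.L
      (ModAddU.hcoh_of (p := fun k => decide (1 ≤ k ∧ k ≤ 3)) (by decide +kernel) fun i _ k hk => by
        simp only [decide_eq_true_eq] at hk
        obtain ⟨hk₁, hk₂⟩ := hk
        interval_cases k <;> rfl)
      (fun φ hφ => by
        simp only [ZADDF, List.mem_cons, List.not_mem_nil, or_false] at hφ
        rcases hφ with rfl | rfl | rfl
        exacts [hΓ hMM.1.1, hΓ hMM.2.1.2.1, hΓ hCA.2.1])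
      (d.avail_act (hMM.mono hΓ) (hCA.mono hΓ) (fun i hi => hΓ (hza i hi)) (fun i hi => hΓ (hzb i hi)))
  · refine Scaffold.isBlock_of_forall fun θ hθ => ?_
    obtain ⟨i, hi, rfl⟩ := List.mem_map.1 hθ
    rw [List.mem_range] at hi
    exact Or.inr (System.isInferredFrom_end zaddfLeavesOK.inv_ne_zero (hGK _ (mem_maskRules (i := 2) (by decide)))
      zaddfLeavesOK.2.1 (ModAddU.ne_zero_of_allVarsB (by decide +kernel)) K d.act i
      (mem 0 (by omega) (System.mem_lines ZADDF K d.act hi.le))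
      (d.avail_act (hMM.mono hΓ) (hCA.mono hΓ) (fun i hi => hΓ (hza i hi)) (fun i hi => hΓ (hzb i hi)) i hi))
  · exact FregeSystem.IsBlock.singleton (Or.inr (System.isInferredFrom_end zaddfLeavesOK.inv_ne_zero
      (hGK _ (mem_maskRules (i := 3) (by decide))) (System.forall_ne_zero_of_shapesOKB (by decide +kernel))
      (ModAddU.ne_zero_of_allVarsB (by decide +kernel)) K d.act d.L
      (mem 0 (by omega) (System.mem_lines ZADDF K d.act le_rfl)) fun φ hφ => by
        rw [List.mem_singleton.1 hφ]; exact hΓ hlt))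
  · refine Scaffold.isBlock_of_forall fun θ hθ => ?_
    obtain ⟨i, hi, rfl⟩ := List.mem_map.1 hθ
    rw [List.mem_range] at hi
    exact Or.inr (FregeSystem.IsInferredFrom.of_rule (hGK _ (mem_maskRules (i := 4) (by decide)))
      (FregeSystem.sub [K, var (d.MM.R d.L i), var (d.MM.ge d.L), var (d.MM.d d.L i), var (d.MM.S.s i)]) rfl
      (FregeSystem.prems_cons (hΓ (hMM.2.2 i hi)) (FregeSystem.prems_cons (mem 2 (by omega) (List.mem_singleton_self _))
        (FregeSystem.prems_cons (mem 1 (by omega) (List.mem_map.2 ⟨i, List.mem_range.2 hi, rfl⟩)) FregeSystem.prems_nil))))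
  · refine Scaffold.isBlock_of_forall fun θ hθ => ?_
    obtain ⟨i, hi, rfl⟩ := List.mem_map.1 hθ
    rw [List.mem_range] at hi
    exact Or.inr (Logic.infer hGL 10 (by decide) (FregeSystem.sub [K, var (d.w i), var (d.MM.R d.L i)]) rfl
      (FregeSystem.prems_cons (hΓ (hw i hi)) (FregeSystem.prems_cons (mem 3 (by omega)
        (List.mem_map.2 ⟨i, List.mem_range.2 hi, rfl⟩)) FregeSystem.prems_nil)))

/-- The conclusions of the zero block. [folklore] -/
theorem mem_segs {i : ℕ} (hi : i < d.L) : ctx K (eqv (d.w i) (d.MM.R d.L i)) ∈ (d.segs K).flatten := by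
  simp only [segs, List.flatten_cons, List.flatten_nil, List.mem_append, List.append_nil]
  exact Or.inr (Or.inr (Or.inr (Or.inr (List.mem_map.2 ⟨i, List.mem_range.2 hi, rfl⟩))))

/-- Every line of the zero block has size `≤ |K| + 12`. [folklore] -/
theorem bounded_segs (K : PropForm ℕ) : ModAddU.Bounded (K.size + 12) (d.segs K).flatten := by
  have hZ : ZADDF.inv.size = 10 := by decide +kernel
  refine ModAddU.Bounded.flatten fun D hD => ?_
  simp only [segs, List.mem_cons, List.not_mem_nil, or_false] at hD
  rcases hD with rfl | rfl | rfl | rfl | rfl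
  · exact ModAddU.bounded_sysLines _ _ _ _ (by omega)
  · exact ModAddU.Bounded.map fun i _ => by rw [ModAddU.size_ctx, ModAddU.size_inst]; simp [size]
  · exact ModAddU.Bounded.singleton (by rw [ModAddU.size_ctx, ModAddU.size_inst]; simp [size])
  · exact ModAddU.Bounded.map fun i _ => by rw [ModAddU.size_ctx]; simp [size]
  · exact ModAddU.bounded_ctx_eqv _ (by omega) _ _ _

/-- The zero block has `4L + 2` lines. [folklore] -/
theorem length_segs (K : PropForm ℕ) : (d.segs K).flatten.length = 4 * d.L + 2 := by
  simp only [segs, List.flatten_cons, List.flatten_nil, List.length_append, List.length_map, List.length_range,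
    System.lines, List.length_cons, List.length_nil, List.append_nil]
  ring

end ZeroData

/-! ### The stage of the distributivity law -/

section Stage

variable (L) (o : Occ) (K : PropForm ℕ) (m t : ℕ)

/-- `P_t(VX)`. [folklore] -/
def u : ℕ → ℕ := (VX L o).P L t
/-- `P_t(VY)`. [folklore] -/
def v : ℕ → ℕ := (VY L o).P L t
/-- The views of `MF1_t`. [folklore] -/
def N11 : ModAddU.View := ModAddU.MFI.N₁ (MF1 L o t) L
/-- The views of `MF1_t`. [folklore] -/
def N12 : ModAddU.View := ModAddU.MFI.N₂ (MF1 L o t) L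
/-- The views of `MF1_t`. [folklore] -/
def N13 : ModAddU.View := ModAddU.MFI.N₃ (MF1 L o t) L
/-- The views of `MF1_t`. [folklore] -/
def N14 : ModAddU.View := ModAddU.MFI.N₄ (MF1 L o t) L
/-- The views of `MF1_t`. [folklore] -/
def N15 : ModAddU.View := ModAddU.MFI.N₅ (MF1 L o t) L
/-- The views of `MF1_t`. [folklore] -/
def N16 : ModAddU.View := ModAddU.MFI.N₆ (MF1 L o t) L
/-- The views of `MF2_t`. [folklore] -/
def N21 : ModAddU.View := ModAddU.MFI.N₁ (MF2 L o t) L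
/-- The views of `MF2_t`. [folklore] -/
def N22 : ModAddU.View := ModAddU.MFI.N₂ (MF2 L o t) L
/-- The views of `MF2_t`. [folklore] -/
def N23 : ModAddU.View := ModAddU.MFI.N₃ (MF2 L o t) L
/-- The views of `MF2_t`. [folklore] -/
def N24 : ModAddU.View := ModAddU.MFI.N₄ (MF2 L o t) L
/-- The views of `MF2_t`. [folklore] -/
def N25 : ModAddU.View := ModAddU.MFI.N₅ (MF2 L o t) L
/-- The views of `MF2_t`. [folklore] -/
def N26 : ModAddU.View := ModAddU.MFI.N₆ (MF2 L o t) L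

/-- The mask data of stage `t`. [folklore] -/
def md : MaskData where
  L := L
  g := bw L o (L - 1 - t)
  x := x o
  y := y L o
  nw := ModAddU.MFI.n (MF2 L o t) L
  mx := (VX L o).msk L t
  my := (VY L o).msk L t
  mS := (VS L o).msk L t
  bMS := o.base
  bMM := (MF2 L o t).base + ModAddU.MFI.off L 5
  bCA := (VX L o).rbase L 1
  xa := x o

/-- The zero data (stage `0`). [folklore] -/
def zd : ZeroData where
  L := L
  bMM := (MF1 L o 0).base + ModAddU.MFI.off L 4
  za := ModAddU.MFI.a (MF1 L o 0)
  zb := ModAddU.MFI.b (MF1 L o 0) L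
  nw := ModAddU.MFI.n (MF1 L o 0) L
  bCA := (VX L o).rbase L 1
  xa := x o
  w := (VS L o).P L 0

/-- The linking segments of stage `t ≥ 1` (empty for `t = 0`): `N₆(MF2_{t-1}) ≡ N₁(MF1_t)` and
`P_t(VS) ≡ R(N₁(MF1_t))`. [folklore] -/
def linkSegs : List (List (PropForm ℕ)) :=
  [if t = 0 then [] else (⟨N26 L o (t - 1), N11 L o t, L⟩ : ModAddU.PairData).leibLines K,
   if t = 0 then [] else ModAddU.MFI.transLines K ((VS L o).P L t) ((N11 L o t).R L) L]

/-- The segments of stage `t`. [folklore] -/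
def segs : List (List (PropForm ℕ)) :=
  [Adder.reflLines K ((List.range L).map (u L o t) ++ (List.range L).map (v L o t) ++ (List.range L).map (n L o) ++
      (List.range L).map (((VX L o).Dv L t).R L) ++ (List.range L).map (((VY L o).Dv L t).R L) ++
      (List.range L).map ((VX L o).msk L t) ++ (List.range L).map ((VY L o).msk L t))] ++
  linkSegs L o K t ++
  [ModAddU.AssocKit.transferLines ((VX L o).CP L t) (ModAddU.MFI.Ca (MF1 L o t) L) K L,
   ModAddU.AssocKit.transferLines ((VY L o).CP L t) (ModAddU.MFI.Cb (MF1 L o t) L) K L,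
   ModAddU.AssocKit.transferLines ((VX L o).CP L t) (ModAddU.MFI.Cc (MF1 L o t) L) K L,
   ModAddU.AssocKit.transferLines ((VY L o).CP L t) (ModAddU.MFI.Cd (MF1 L o t) L) K L,
   ModAddU.MFI.lines (MF1 L o t) L K m,
   (⟨N11 L o t, N12 L o t, L⟩ : ModAddU.PairData).leibLines K,
   ModAddU.MFI.transLines K ((VS L o).P L t) ((N12 L o t).R L) L,
   (⟨(VS L o).Dv L t, N13 L o t, L⟩ : ModAddU.PairData).leibLines K,
   (⟨N14 L o t, (VX L o).Dv L t, L⟩ : ModAddU.PairData).leibLines K,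
   (⟨N15 L o t, (VY L o).Dv L t, L⟩ : ModAddU.PairData).leibLines K,
   (⟨N16 L o t, N21 L o t, L⟩ : ModAddU.PairData).leibLines K,
   (md L o t).maskLines K,
   ModAddU.MFI.transLines K (((VS L o).Dv L t).R L) ((N16 L o t).R L) L,
   ModAddU.MFI.transLines K (((VS L o).Dv L t).R L) ((N21 L o t).R L) L,
   (⟨(VS L o).Av L t, N23 L o t, L⟩ : ModAddU.PairData).leibLines K,
   ModAddU.AssocKit.transferLines ((VX L o).CD L t) (ModAddU.MFI.Ca (MF2 L o t) L) K L,
   ModAddU.AssocKit.transferLines ((VY L o).CD L t) (ModAddU.MFI.Cb (MF2 L o t) L) K L,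
   ModAddU.AssocKit.transferLines ((VX L o).CM L t) (ModAddU.MFI.Cc (MF2 L o t) L) K L,
   ModAddU.AssocKit.transferLines ((VY L o).CM L t) (ModAddU.MFI.Cd (MF2 L o t) L) K L,
   ModAddU.MFI.lines (MF2 L o t) L K m,
   (⟨N24 L o t, (VX L o).Av L t, L⟩ : ModAddU.PairData).leibLines K,
   (⟨N25 L o t, (VY L o).Av L t, L⟩ : ModAddU.PairData).leibLines K,
   ModAddU.MFI.transLines K (((VS L o).Av L t).R L) ((N26 L o t).R L) L]

end Stage

/-- The length of the segment list. [folklore] -/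
theorem length_segs (L : ℕ) (o : Occ) (K : PropForm ℕ) (m t : ℕ) : (segs L o K m t).length = 26 := rfl

variable {G : FregeSystem}

/-- Availability of the pieces is monotone. [folklore] -/
theorem LAvail.mono {L : ℕ} {o : Occ} {K : PropForm ℕ} {Γ Γ' : Set (PropForm ℕ)} (h : LAvail L o K Γ) (hΓ : Γ ⊆ Γ') :
    LAvail L o K Γ' :=
  ⟨h.hMS.mono hΓ, h.hVX.mono hΓ, h.hVY.mono hΓ, h.hVS.mono hΓ, fun t ht => (h.hMF1 t ht).mono hΓ,
    fun t ht => (h.hMF2 t ht).mono hΓ, h.hRL.mono hΓ⟩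

/-- **Stage `t` of the distributivity law.** From the facts of the certified multipliers `VX`,
`VY` (ranges and high bits), `x < n`, the high bits of `n`, and the induction hypothesis
`P_t(VS) ≡ P_t(VX) ⊕ P_t(VY)` (for `t = 0` as a hypothesis, for `t ≥ 1` linked from the
conclusion of stage `t - 1`), the segments of stage `t` form a block whose last segment is
`P_{t+1}(VS) ≡ R(N₆(MF2_t))`, i.e. `P_{t+1}(VS) ≡ P_{t+1}(VX) ⊕ P_{t+1}(VY)` up to the link of
the next stage. [cite: CookReckhow1979, §2; Krajicek1995, §9.2] -/
theorem isBlock_segs (hG : ∀ r ∈ ModAddU.assocRules, r ∈ G.rules) (hGM : ∀ r ∈ ModAddU.rules, r ∈ G.rules)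
    (hGR : ∀ r ∈ rangeRules, r ∈ G.rules) (hGN : ∀ r ∈ Netlist.rules, r ∈ G.rules)
    (hGA : ∀ r ∈ Adder.rules, r ∈ G.rules) (hGL : ∀ r ∈ Logic.rules, r ∈ G.rules)
    (hGG : ∀ r ∈ ModAddU.glueRules, r ∈ G.rules) (hGK : ∀ r ∈ maskRules, r ∈ G.rules) {T : Set (PropForm ℕ)}
    (h : LAvail L o K T) {m t : ℕ} (hm : m + 2 ≤ L) (ht : t < L)
    (hx : ctx K (neg (var (((VX L o).CA L).ge L L))) ∈ T) (hn : ∀ i, m ≤ i → i < L → ctx K (neg (var (n L o i))) ∈ T)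
    (hrX : ∀ χ ∈ (VX L o).rangeLines L K, χ ∈ T) (hrY : ∀ χ ∈ (VY L o).rangeLines L K, χ ∈ T)
    (hhX : ∀ χ ∈ (VX L o).highAll L K m, χ ∈ T) (hhY : ∀ χ ∈ (VY L o).highAll L K m, χ ∈ T)
    (hIH0 : t = 0 → ∀ i < L, ctx K (eqv ((VS L o).P L 0 i) ((N11 L o 0).R L i)) ∈ T)
    (hprev : 0 < t → (∀ i < L, ctx K (eqv ((VS L o).P L t i) ((N26 L o (t - 1)).R L i)) ∈ T) ∧
      (∀ i < L, ctx K (eqv ((N24 L o (t - 1)).R L i) (((VX L o).Av L (t - 1)).R L i)) ∈ T) ∧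
      (∀ i < L, ctx K (eqv ((N25 L o (t - 1)).R L i) (((VY L o).Av L (t - 1)).R L i)) ∈ T)) :
    G.IsBlock T (segs L o K m t).flatten := by
  -- availability of the interchange kits and their views
  have hM1 : ModAddU.MFI.MAvail (MF1 L o t) L K T := ModAddU.MFI.avail_ofOcc (h.hMF1 t ht)
  have hM2 : ModAddU.MFI.MAvail (MF2 L o t) L K T := ModAddU.MFI.avail_ofOcc (h.hMF2 t ht)
  -- the inputs of the kits
  have e1a : ∀ i < L, ModAddU.MFI.a (MF1 L o t) i = (VX L o).P L t i := fun i hi => (MF1_inp ht hi).1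
  have e1b : ∀ i < L, ModAddU.MFI.b (MF1 L o t) L i = (VY L o).P L t i := fun i hi => (MF1_inp ht hi).2.1
  have e1c : ∀ i < L, ModAddU.MFI.c (MF1 L o t) L i = (VX L o).P L t i := fun i hi => (MF1_inp ht hi).2.2.1
  have e1d : ∀ i < L, ModAddU.MFI.d (MF1 L o t) L i = (VY L o).P L t i := fun i hi => (MF1_inp ht hi).2.2.2.1
  have e1n : ∀ i < L, ModAddU.MFI.n (MF1 L o t) L i = n L o i := fun i hi => (MF1_inp ht hi).2.2.2.2
  have e2a : ∀ i < L, ModAddU.MFI.a (MF2 L o t) i = ((VX L o).Dv L t).R L i := fun i hi => (MF2_inp ht hi).1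
  have e2b : ∀ i < L, ModAddU.MFI.b (MF2 L o t) L i = ((VY L o).Dv L t).R L i := fun i hi => (MF2_inp ht hi).2.1
  have e2c : ∀ i < L, ModAddU.MFI.c (MF2 L o t) L i = (VX L o).msk L t i := fun i hi => (MF2_inp ht hi).2.2.1
  have e2d : ∀ i < L, ModAddU.MFI.d (MF2 L o t) L i = (VY L o).msk L t i := fun i hi => (MF2_inp ht hi).2.2.2.1
  have e2n : ∀ i < L, ModAddU.MFI.n (MF2 L o t) L i = n L o i := fun i hi => (MF2_inp ht hi).2.2.2.2
  refine ModAddU.AssocData.isBlock_flatten _ fun k hk => ?_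
  rw [length_segs] at hk
  have mem : ∀ {χ} (j : ℕ) (hj : j < k) (hχ : χ ∈ (segs L o K m t)[j]'(by rw [length_segs]; omega)),
      χ ∈ T ∪ {χ | ∃ j, ∃ hj : j < k, χ ∈ (segs L o K m t)[j]'(by rw [length_segs]; omega)} := fun j hj hχ => Or.inr ⟨j, hj, hχ⟩
  have hΓ : T ⊆ T ∪ {χ | ∃ j, ∃ hj : j < k, χ ∈ (segs L o K m t)[j]'(by rw [length_segs]; omega)} := fun _ hχ => Or.inl hχ
  -- reflexivity lines of the seven words
  have rf : 0 < k → ∀ (w : ℕ) (z : ℕ → ℕ), (w = 0 ∧ z = u L o t ∨ w = 1 ∧ z = v L o t ∨ w = 2 ∧ z = n L o ∨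
      w = 3 ∧ z = ((VX L o).Dv L t).R L ∨ w = 4 ∧ z = ((VY L o).Dv L t).R L ∨ w = 5 ∧ z = (VX L o).msk L t ∨
      w = 6 ∧ z = (VY L o).msk L t) → ∀ i < L,
      ctx K (eqv (z i) (z i)) ∈ T ∪ {χ | ∃ j, ∃ hj : j < k, χ ∈ (segs L o K m t)[j]'(by rw [length_segs]; omega)} := by
    intro hk0 w z hz i hi
    refine mem 0 hk0 (Adder.mem_reflLines ?_)
    simp only [List.mem_append, List.mem_map, List.mem_range]
    rcases hz with ⟨-, rfl⟩ | ⟨-, rfl⟩ | ⟨-, rfl⟩ | ⟨-, rfl⟩ | ⟨-, rfl⟩ | ⟨-, rfl⟩ | ⟨-, rfl⟩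
    · exact Or.inl (Or.inl (Or.inl (Or.inl (Or.inl (Or.inl ⟨i, hi, rfl⟩)))))
    · exact Or.inl (Or.inl (Or.inl (Or.inl (Or.inl (Or.inr ⟨i, hi, rfl⟩)))))
    · exact Or.inl (Or.inl (Or.inl (Or.inl (Or.inr ⟨i, hi, rfl⟩))))
    · exact Or.inl (Or.inl (Or.inl (Or.inr ⟨i, hi, rfl⟩)))
    · exact Or.inl (Or.inl (Or.inr ⟨i, hi, rfl⟩))
    · exact Or.inl (Or.inr ⟨i, hi, rfl⟩)
    · exact Or.inr ⟨i, hi, rfl⟩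
  -- the induction hypothesis, as available before the main segments
  have ih : 2 < k → ∀ i < L,
      ctx K (eqv ((VS L o).P L t i) ((N11 L o t).R L i)) ∈ T ∪ {χ | ∃ j, ∃ hj : j < k, χ ∈ (segs L o K m t)[j]'(by rw [length_segs]; omega)} := by
    intro hk2 i hi
    rcases Nat.eq_zero_or_pos t with rfl | ht0
    · exact hΓ (hIH0 rfl i hi)
    · refine mem 2 hk2 ?_
      show _ ∈ (if t = 0 then [] else ModAddU.MFI.transLines K ((VS L o).P L t) ((N11 L o t).R L) L)
      rw [if_neg (by omega)]; exact Netlist.mem_map_range hi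
  -- range facts of the certified multipliers
  have rX := fun (s : ℕ) (hs : s ≤ L) => hrX _ (View.mem_rangeLines_P (V := VX L o) (K := K) hs)
  have rY := fun (s : ℕ) (hs : s ≤ L) => hrY _ (View.mem_rangeLines_P (V := VY L o) (K := K) hs)
  interval_cases k
  · -- 0: reflexivity
    exact Adder.isBlock_reflLines hGA _ _ _
  · -- 1: link `N₆(MF2_{t-1}) ≡ N₁(MF1_t)` (stage `t ≥ 1`)
    show G.IsBlock _ (if t = 0 then [] else _)
    split_ifs with ht0
    · exact FregeSystem.IsBlock.nil _ _
    · obtain ⟨-, hp1, hp2⟩ := hprev (by omega)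
      have hMp : ModAddU.MFI.MAvail (MF2 L o (t - 1)) L K T := ModAddU.MFI.avail_ofOcc (h.hMF2 (t - 1) (by omega))
      refine (⟨N26 L o (t - 1), N11 L o t, L⟩ : ModAddU.PairData).isBlock_leibLines hGN hGL (hMp.hN₆.mono hΓ) (hM1.hN₁.mono hΓ)
        (fun i hi => ?_) (fun i hi => ?_) (fun i hi => ?_)
      · show ctx K (eqv ((N24 L o (t - 1)).R L i) (ModAddU.MFI.a (MF1 L o t) i)) ∈ _
        rw [e1a i hi, show (VX L o).P L t i = ((VX L o).Av L (t - 1)).R L i from by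
          rw [← View.P_succ, show t - 1 + 1 = t by omega]]
        exact hΓ (hp1 i hi)
      · show ctx K (eqv ((N25 L o (t - 1)).R L i) (ModAddU.MFI.b (MF1 L o t) L i)) ∈ _
        rw [e1b i hi, show (VY L o).P L t i = ((VY L o).Av L (t - 1)).R L i from by
          rw [← View.P_succ, show t - 1 + 1 = t by omega]]
        exact hΓ (hp2 i hi)
      · have e2n' : ∀ i < L, ModAddU.MFI.n (MF2 L o (t - 1)) L i = n L o i := fun i hi => (MF2_inp (by omega) hi).2.2.2.2
        show ctx K (eqv (ModAddU.MFI.n (MF2 L o (t - 1)) L i) (ModAddU.MFI.n (MF1 L o t) L i)) ∈ _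
        rw [e1n i hi, e2n' i hi]
        exact rf (by omega) 2 (n L o) (by simp) i hi
  · -- 2: link `P_t(VS) ≡ R(N₁(MF1_t))` (stage `t ≥ 1`)
    show G.IsBlock _ (if t = 0 then [] else _)
    split_ifs with ht0
    · exact FregeSystem.IsBlock.nil _ _
    · obtain ⟨hp0, -, -⟩ := hprev (by omega)
      refine ModAddU.MFI.isBlock_transLines hGL K (fun i hi => hΓ (hp0 i hi)) fun i hi => mem 1 (by omega) ?_
      show _ ∈ (if t = 0 then [] else _)
      rw [if_neg ht0]
      exact (⟨N26 L o (t - 1), N11 L o t, L⟩ : ModAddU.PairData).mem_leibLines hi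
  · -- 3: transfer `P_t(VX) < n` into `MF1`'s comparator `Ca`
    exact ModAddU.AssocKit.isBlock_transferLines hGN hGA hGL ((h.hVX.hCP ht.le).mono hΓ) (hM1.hCa.mono hΓ)
      (fun i hi => (e1a i hi).symm) (fun i hi => (e1n i hi).symm) (hΓ (rX t ht.le))
  · -- 4
    exact ModAddU.AssocKit.isBlock_transferLines hGN hGA hGL ((h.hVY.hCP ht.le).mono hΓ) (hM1.hCb.mono hΓ)
      (fun i hi => (e1b i hi).symm) (fun i hi => (e1n i hi).symm) (hΓ (rY t ht.le))
  · -- 5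
    exact ModAddU.AssocKit.isBlock_transferLines hGN hGA hGL ((h.hVX.hCP ht.le).mono hΓ) (hM1.hCc.mono hΓ)
      (fun i hi => (e1c i hi).symm) (fun i hi => (e1n i hi).symm) (hΓ (rX t ht.le))
  · -- 6
    exact ModAddU.AssocKit.isBlock_transferLines hGN hGA hGL ((h.hVY.hCP ht.le).mono hΓ) (hM1.hCd.mono hΓ)
      (fun i hi => (e1d i hi).symm) (fun i hi => (e1n i hi).symm) (hΓ (rY t ht.le))
  · -- 7: the interchange `(u⊕v)⊕(u⊕v) ≡ (u⊕u)⊕(v⊕v)`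
    refine ModAddU.MFI.isBlock_lines hG hGM hGR hGN hGA hGL hGG (ModAddU.MFI.MAvail.mono hM1 hΓ) hm
      (mem 3 (by omega) (ModAddU.AssocKit.mem_transferLines _ _ _ _)) (mem 4 (by omega) (ModAddU.AssocKit.mem_transferLines _ _ _ _))
      (mem 5 (by omega) (ModAddU.AssocKit.mem_transferLines _ _ _ _)) (mem 6 (by omega) (ModAddU.AssocKit.mem_transferLines _ _ _ _))
      (fun i h₁ h₂ => ?_) (fun i h₁ h₂ => ?_) (fun i h₁ h₂ => ?_) (fun i h₁ h₂ => ?_) (fun i h₁ h₂ => ?_)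
    · rw [e1a i h₂]; exact hΓ (hhX _ (View.mem_highAll_P ht.le h₁ h₂))
    · rw [e1b i h₂]; exact hΓ (hhY _ (View.mem_highAll_P ht.le h₁ h₂))
    · rw [e1c i h₂]; exact hΓ (hhX _ (View.mem_highAll_P ht.le h₁ h₂))
    · rw [e1d i h₂]; exact hΓ (hhY _ (View.mem_highAll_P ht.le h₁ h₂))
    · rw [e1n i h₂]; exact hΓ (hn i h₁ h₂)
  · -- 8: `N₁(MF1) ≡ N₂(MF1)` (both `u ⊕ v`)
    refine (⟨N11 L o t, N12 L o t, L⟩ : ModAddU.PairData).isBlock_leibLines hGN hGL (hM1.hN₁.mono hΓ) (hM1.hN₂.mono hΓ)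
      (fun i hi => ?_) (fun i hi => ?_) (fun i hi => ?_)
    · show ctx K (eqv (ModAddU.MFI.a (MF1 L o t) i) (ModAddU.MFI.c (MF1 L o t) L i)) ∈ _
      rw [e1a i hi, e1c i hi]; exact rf (by omega) 0 (u L o t) (by simp [u]) i hi
    · show ctx K (eqv (ModAddU.MFI.b (MF1 L o t) L i) (ModAddU.MFI.d (MF1 L o t) L i)) ∈ _
      rw [e1b i hi, e1d i hi]; exact rf (by omega) 1 (v L o t) (by simp [v]) i hi
    · show ctx K (eqv (ModAddU.MFI.n (MF1 L o t) L i) (ModAddU.MFI.n (MF1 L o t) L i)) ∈ _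
      rw [e1n i hi]; exact rf (by omega) 2 (n L o) (by simp) i hi
  · -- 9: `P_t(VS) ≡ R(N₂(MF1))`
    exact ModAddU.MFI.isBlock_transLines hGL K (ih (by omega))
      fun i hi => mem 8 (by omega) ((⟨N11 L o t, N12 L o t, L⟩ : ModAddU.PairData).mem_leibLines hi)
  · -- 10: `D_t(VS) ≡ N₃(MF1)`
    refine (⟨(VS L o).Dv L t, N13 L o t, L⟩ : ModAddU.PairData).isBlock_leibLines hGN hGL ((h.hVS.hV.hD t ht).mono hΓ)
      (hM1.hN₃.mono hΓ) (ih (by omega)) (fun i hi => mem 9 (by omega) (Netlist.mem_map_range hi)) (fun i hi => ?_)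
    show ctx K (eqv (n L o i) (ModAddU.MFI.n (MF1 L o t) L i)) ∈ _
    rw [e1n i hi]; exact rf (by omega) 2 (n L o) (by simp) i hi
  · -- 11: `N₄(MF1) ≡ D_t(VX)` (both `u ⊕ u`)
    refine (⟨N14 L o t, (VX L o).Dv L t, L⟩ : ModAddU.PairData).isBlock_leibLines hGN hGL (hM1.hN₄.mono hΓ)
      ((h.hVX.hV.hD t ht).mono hΓ) (fun i hi => ?_) (fun i hi => ?_) (fun i hi => ?_)
    · show ctx K (eqv (ModAddU.MFI.a (MF1 L o t) i) ((VX L o).P L t i)) ∈ _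
      rw [e1a i hi]; exact rf (by omega) 0 (u L o t) (by simp [u]) i hi
    · show ctx K (eqv (ModAddU.MFI.c (MF1 L o t) L i) ((VX L o).P L t i)) ∈ _
      rw [e1c i hi]; exact rf (by omega) 0 (u L o t) (by simp [u]) i hi
    · show ctx K (eqv (ModAddU.MFI.n (MF1 L o t) L i) (n L o i)) ∈ _
      rw [e1n i hi]; exact rf (by omega) 2 (n L o) (by simp) i hi
  · -- 12: `N₅(MF1) ≡ D_t(VY)`
    refine (⟨N15 L o t, (VY L o).Dv L t, L⟩ : ModAddU.PairData).isBlock_leibLines hGN hGL (hM1.hN₅.mono hΓ)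
      ((h.hVY.hV.hD t ht).mono hΓ) (fun i hi => ?_) (fun i hi => ?_) (fun i hi => ?_)
    · show ctx K (eqv (ModAddU.MFI.b (MF1 L o t) L i) ((VY L o).P L t i)) ∈ _
      rw [e1b i hi]; exact rf (by omega) 1 (v L o t) (by simp [v]) i hi
    · show ctx K (eqv (ModAddU.MFI.d (MF1 L o t) L i) ((VY L o).P L t i)) ∈ _
      rw [e1d i hi]; exact rf (by omega) 1 (v L o t) (by simp [v]) i hi
    · show ctx K (eqv (ModAddU.MFI.n (MF1 L o t) L i) (n L o i)) ∈ _
      rw [e1n i hi]; exact rf (by omega) 2 (n L o) (by simp) i hi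
  · -- 13: `N₆(MF1) ≡ N₁(MF2)`
    refine (⟨N16 L o t, N21 L o t, L⟩ : ModAddU.PairData).isBlock_leibLines hGN hGL (hM1.hN₆.mono hΓ) (hM2.hN₁.mono hΓ)
      (fun i hi => ?_) (fun i hi => ?_) (fun i hi => ?_)
    · show ctx K (eqv ((N14 L o t).R L i) (ModAddU.MFI.a (MF2 L o t) i)) ∈ _
      rw [e2a i hi]; exact mem 11 (by omega) ((⟨N14 L o t, (VX L o).Dv L t, L⟩ : ModAddU.PairData).mem_leibLines hi)
    · show ctx K (eqv ((N15 L o t).R L i) (ModAddU.MFI.b (MF2 L o t) L i)) ∈ _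
      rw [e2b i hi]; exact mem 12 (by omega) ((⟨N15 L o t, (VY L o).Dv L t, L⟩ : ModAddU.PairData).mem_leibLines hi)
    · show ctx K (eqv (ModAddU.MFI.n (MF1 L o t) L i) (ModAddU.MFI.n (MF2 L o t) L i)) ∈ _
      rw [e1n i hi, e2n i hi]; exact rf (by omega) 2 (n L o) (by simp) i hi
  · -- 14: the masks distribute: `mk_t(VS) ≡ R(N₂(MF2)) = mk_t(VX) ⊕ mk_t(VY)`
    refine (md L o t).isBlock_maskLines hGK hGN hGA hGL hGG ?_ ?_ ?_ (fun θ hθ => ?_) (hΓ hx)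
    · refine ModAddU.View.Avail.congr (hM2.hN₂.mono hΓ) rfl (fun i hi => ?_) (fun i hi => ?_) (fun i hi => rfl)
      · exact (e2c i hi).symm
      · exact (e2d i hi).symm
    · exact ModAddU.View.Avail.congr (h.hMS.mono hΓ) rfl (fun i hi => rfl) (fun i hi => rfl) (fun i hi => e2n i hi)
    · exact Sub.View.Avail.congr (h.hVX.hCA.mono hΓ) rfl (fun i hi => rfl) (fun i hi => e2n i hi)
    · simp only [MaskData.maskDefs, List.mem_append, List.mem_map, List.mem_range] at hθ
      rcases hθ with ⟨i, hi, rfl⟩ | ⟨i, hi, rfl⟩ | ⟨i, hi, rfl⟩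
      exacts [hΓ (h.hVX.hV.hmk t ht i hi), hΓ (h.hVY.hV.hmk t ht i hi), hΓ (h.hVS.hV.hmk t ht i hi)]
  · -- 15: `R(D_t(VS)) ≡ R(N₆(MF1))`
    exact ModAddU.MFI.isBlock_transLines hGL K
      (fun i hi => mem 10 (by omega) ((⟨(VS L o).Dv L t, N13 L o t, L⟩ : ModAddU.PairData).mem_leibLines hi))
      (fun i hi => mem 7 (by omega) (ModAddU.MFI.mem_lines hi))
  · -- 16: `R(D_t(VS)) ≡ R(N₁(MF2))`
    exact ModAddU.MFI.isBlock_transLines hGL K (fun i hi => mem 15 (by omega) (Netlist.mem_map_range hi))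
      (fun i hi => mem 13 (by omega) ((⟨N16 L o t, N21 L o t, L⟩ : ModAddU.PairData).mem_leibLines hi))
  · -- 17: `A_t(VS) ≡ N₃(MF2)`
    refine (⟨(VS L o).Av L t, N23 L o t, L⟩ : ModAddU.PairData).isBlock_leibLines hGN hGL ((h.hVS.hV.hA t ht).mono hΓ)
      (hM2.hN₃.mono hΓ) (fun i hi => mem 16 (by omega) (Netlist.mem_map_range hi))
      (fun i hi => mem 14 (by omega) ((md L o t).mem_maskLines hi)) (fun i hi => ?_)
    show ctx K (eqv (n L o i) (ModAddU.MFI.n (MF2 L o t) L i)) ∈ _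
    rw [e2n i hi]; exact rf (by omega) 2 (n L o) (by simp) i hi
  · -- 18: transfer `R(D_t(VX)) < n` into `MF2`'s comparator `Ca`
    exact ModAddU.AssocKit.isBlock_transferLines hGN hGA hGL ((h.hVX.hCD t ht).mono hΓ) (hM2.hCa.mono hΓ)
      (fun i hi => (e2a i hi).symm) (fun i hi => (e2n i hi).symm) (hΓ (hrX _ (View.mem_rangeLines_D ht)))
  · -- 19
    exact ModAddU.AssocKit.isBlock_transferLines hGN hGA hGL ((h.hVY.hCD t ht).mono hΓ) (hM2.hCb.mono hΓ)
      (fun i hi => (e2b i hi).symm) (fun i hi => (e2n i hi).symm) (hΓ (hrY _ (View.mem_rangeLines_D ht)))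
  · -- 20
    exact ModAddU.AssocKit.isBlock_transferLines hGN hGA hGL ((h.hVX.hCM t ht).mono hΓ) (hM2.hCc.mono hΓ)
      (fun i hi => (e2c i hi).symm) (fun i hi => (e2n i hi).symm) (hΓ (hrX _ (View.mem_rangeLines_M ht)))
  · -- 21
    exact ModAddU.AssocKit.isBlock_transferLines hGN hGA hGL ((h.hVY.hCM t ht).mono hΓ) (hM2.hCd.mono hΓ)
      (fun i hi => (e2d i hi).symm) (fun i hi => (e2n i hi).symm) (hΓ (hrY _ (View.mem_rangeLines_M ht)))
  · -- 22: the interchange `(Dx⊕Dy)⊕(mx⊕my) ≡ (Dx⊕mx)⊕(Dy⊕my)`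
    refine ModAddU.MFI.isBlock_lines hG hGM hGR hGN hGA hGL hGG (ModAddU.MFI.MAvail.mono hM2 hΓ) hm
      (mem 18 (by omega) (ModAddU.AssocKit.mem_transferLines _ _ _ _)) (mem 19 (by omega) (ModAddU.AssocKit.mem_transferLines _ _ _ _))
      (mem 20 (by omega) (ModAddU.AssocKit.mem_transferLines _ _ _ _)) (mem 21 (by omega) (ModAddU.AssocKit.mem_transferLines _ _ _ _))
      (fun i h₁ h₂ => ?_) (fun i h₁ h₂ => ?_) (fun i h₁ h₂ => ?_) (fun i h₁ h₂ => ?_) (fun i h₁ h₂ => ?_)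
    · rw [e2a i h₂]; exact hΓ (hhX _ (View.mem_highAll_D ht h₁ h₂))
    · rw [e2b i h₂]; exact hΓ (hhY _ (View.mem_highAll_D ht h₁ h₂))
    · rw [e2c i h₂]; exact hΓ (hhX _ (View.mem_highAll_M ht h₁ h₂))
    · rw [e2d i h₂]; exact hΓ (hhY _ (View.mem_highAll_M ht h₁ h₂))
    · rw [e2n i h₂]; exact hΓ (hn i h₁ h₂)
  · -- 23: `N₄(MF2) ≡ A_t(VX)` (both `Dx ⊕ mx`)
    refine (⟨N24 L o t, (VX L o).Av L t, L⟩ : ModAddU.PairData).isBlock_leibLines hGN hGL (hM2.hN₄.mono hΓ)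
      ((h.hVX.hV.hA t ht).mono hΓ) (fun i hi => ?_) (fun i hi => ?_) (fun i hi => ?_)
    · show ctx K (eqv (ModAddU.MFI.a (MF2 L o t) i) (((VX L o).Dv L t).R L i)) ∈ _
      rw [e2a i hi]; exact rf (by omega) 3 (((VX L o).Dv L t).R L) (by simp) i hi
    · show ctx K (eqv (ModAddU.MFI.c (MF2 L o t) L i) ((VX L o).msk L t i)) ∈ _
      rw [e2c i hi]; exact rf (by omega) 5 ((VX L o).msk L t) (by simp) i hi
    · show ctx K (eqv (ModAddU.MFI.n (MF2 L o t) L i) (n L o i)) ∈ _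
      rw [e2n i hi]; exact rf (by omega) 2 (n L o) (by simp) i hi
  · -- 24: `N₅(MF2) ≡ A_t(VY)`
    refine (⟨N25 L o t, (VY L o).Av L t, L⟩ : ModAddU.PairData).isBlock_leibLines hGN hGL (hM2.hN₅.mono hΓ)
      ((h.hVY.hV.hA t ht).mono hΓ) (fun i hi => ?_) (fun i hi => ?_) (fun i hi => ?_)
    · show ctx K (eqv (ModAddU.MFI.b (MF2 L o t) L i) (((VY L o).Dv L t).R L i)) ∈ _
      rw [e2b i hi]; exact rf (by omega) 4 (((VY L o).Dv L t).R L) (by simp) i hi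
    · show ctx K (eqv (ModAddU.MFI.d (MF2 L o t) L i) ((VY L o).msk L t i)) ∈ _
      rw [e2d i hi]; exact rf (by omega) 6 ((VY L o).msk L t) (by simp) i hi
    · show ctx K (eqv (ModAddU.MFI.n (MF2 L o t) L i) (n L o i)) ∈ _
      rw [e2n i hi]; exact rf (by omega) 2 (n L o) (by simp) i hi
  · -- 25: `P_{t+1}(VS) = R(A_t(VS)) ≡ R(N₆(MF2))`
    exact ModAddU.MFI.isBlock_transLines hGL K
      (fun i hi => mem 17 (by omega) ((⟨(VS L o).Av L t, N23 L o t, L⟩ : ModAddU.PairData).mem_leibLines hi))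
      (fun i hi => mem 22 (by omega) (ModAddU.MFI.mem_lines hi))

/-! ### The whole law -/

section Whole

variable (L) (o : Occ) (K : PropForm ℕ) (m : ℕ)

/-- The constant facts `¬z(VX)`, `¬z(VY)`, `¬z(VS)`. [folklore] -/
def consts : List (PropForm ℕ) :=
  [ctx K (neg (var (VX L o).z)), ctx K (neg (var (VY L o).z)), ctx K (neg (var (VS L o).z))]

/-- The stages below `t`, after the constant facts and the zero block. [folklore] -/
def ldUpTo : ℕ → List (PropForm ℕ)
  | 0 => consts L o K ++ ((zd L o).segs K).flatten
  | t + 1 => ldUpTo t ++ (segs L o K m t).flatten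

/-- The facts of the certified multipliers `VX`, `VY`: ranges and high bits. [folklore] -/
def prefixLines : List (PropForm ℕ) :=
  (VX L o).rangeLines L K ++ ((VY L o).rangeLines L K ++ ((VX L o).highAll L K m ++ (VY L o).highAll L K m))

/-- The final link `R(N₆(MF2_{L-1})) ≡ R(RL)` and the conclusion `P_L(VS) ≡ R(RL)`. [folklore] -/
def finalLines : List (PropForm ℕ) :=
  (⟨N26 L o (L - 1), RL L o, L⟩ : ModAddU.PairData).leibLines K ++
    ModAddU.MFI.transLines K ((VS L o).P L L) ((RL L o).R L) L

/-- **The lines of the distributivity law.** [folklore] -/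
def lines : List (PropForm ℕ) := prefixLines L o K m ++ (ldUpTo L o K m L ++ finalLines L o K)

end Whole

/-- Conclusions of stage `t` inside `ldUpTo (t + 1)`. [folklore] -/
theorem mem_ldUpTo_succ {m t i : ℕ} (hi : i < L) :
    ctx K (eqv (((VS L o).Av L t).R L i) ((N26 L o t).R L i)) ∈ ldUpTo L o K m (t + 1) ∧
    ctx K (eqv ((N24 L o t).R L i) (((VX L o).Av L t).R L i)) ∈ ldUpTo L o K m (t + 1) ∧
    ctx K (eqv ((N25 L o t).R L i) (((VY L o).Av L t).R L i)) ∈ ldUpTo L o K m (t + 1) := by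
  have h26 : (segs L o K m t).length = 26 := rfl
  refine ⟨List.mem_append_right _ (List.mem_flatten.2 ⟨_, List.getElem_mem (n := 25) (by omega), Netlist.mem_map_range hi⟩),
    List.mem_append_right _ (List.mem_flatten.2 ⟨_, List.getElem_mem (n := 23) (by omega), ?_⟩),
    List.mem_append_right _ (List.mem_flatten.2 ⟨_, List.getElem_mem (n := 24) (by omega), ?_⟩)⟩
  · exact (⟨N24 L o t, (VX L o).Av L t, L⟩ : ModAddU.PairData).mem_leibLines hi
  · exact (⟨N25 L o t, (VY L o).Av L t, L⟩ : ModAddU.PairData).mem_leibLines hi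

/-- The reflexivity line of the modulus inside `ldUpTo (t + 1)`. [folklore] -/
theorem mem_ldUpTo_refl {m t i : ℕ} (hi : i < L) : ctx K (eqv (n L o i) (n L o i)) ∈ ldUpTo L o K m (t + 1) := by
  have h26 : (segs L o K m t).length = 26 := rfl
  refine List.mem_append_right _ (List.mem_flatten.2 ⟨_, List.getElem_mem (n := 0) (by omega), Adder.mem_reflLines ?_⟩)
  simp only [List.mem_append, List.mem_map, List.mem_range]
  exact Or.inl (Or.inl (Or.inl (Or.inl (Or.inr ⟨i, hi, rfl⟩))))

/-- Conclusion of the zero block inside `ldUpTo 0`. [folklore] -/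
theorem mem_ldUpTo_zero {m i : ℕ} (hi : i < L) :
    ctx K (eqv ((VS L o).P L 0 i) ((N11 L o 0).R L i)) ∈ ldUpTo L o K m 0 :=
  List.mem_append_right _ ((zd L o).mem_segs (K := K) hi)

/-- `ldUpTo` is monotone. [folklore] -/
theorem ldUpTo_mono {m s t : ℕ} (hst : s ≤ t) : ∀ χ ∈ ldUpTo L o K m s, χ ∈ ldUpTo L o K m t := by
  induction hst with
  | refl => exact fun χ h => h
  | step _ ih => exact fun χ h => List.mem_append_left _ (ih χ h)

/-- **The stages form a block.** [cite: CookReckhow1979, §2] -/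
theorem isBlock_ldUpTo (hG : ∀ r ∈ ModAddU.assocRules, r ∈ G.rules) (hGM : ∀ r ∈ ModAddU.rules, r ∈ G.rules)
    (hGR : ∀ r ∈ rangeRules, r ∈ G.rules) (hGN : ∀ r ∈ Netlist.rules, r ∈ G.rules)
    (hGA : ∀ r ∈ Adder.rules, r ∈ G.rules) (hGL : ∀ r ∈ Logic.rules, r ∈ G.rules)
    (hGG : ∀ r ∈ ModAddU.glueRules, r ∈ G.rules) (hGK : ∀ r ∈ maskRules, r ∈ G.rules) {T : Set (PropForm ℕ)}
    (h : LAvail L o K T) {m : ℕ} (hm : m + 2 ≤ L)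
    (hx : ctx K (neg (var (((VX L o).CA L).ge L L))) ∈ T) (hn : ∀ i, m ≤ i → i < L → ctx K (neg (var (n L o i))) ∈ T)
    (hrX : ∀ χ ∈ (VX L o).rangeLines L K, χ ∈ T) (hrY : ∀ χ ∈ (VY L o).rangeLines L K, χ ∈ T)
    (hhX : ∀ χ ∈ (VX L o).highAll L K m, χ ∈ T) (hhY : ∀ χ ∈ (VY L o).highAll L K m, χ ∈ T) :
    ∀ t ≤ L, G.IsBlock T (ldUpTo L o K m t) := by
  have hL : 0 < L := by omega
  have hM1 : ModAddU.MFI.MAvail (MF1 L o 0) L K T := ModAddU.MFI.avail_ofOcc (h.hMF1 0 hL)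
  have e1a : ∀ i < L, ModAddU.MFI.a (MF1 L o 0) i = (VX L o).z := fun i hi => (MF1_inp hL hi).1
  have e1b : ∀ i < L, ModAddU.MFI.b (MF1 L o 0) L i = (VY L o).z := fun i hi => (MF1_inp hL hi).2.1
  have e1n : ∀ i < L, ModAddU.MFI.n (MF1 L o 0) L i = n L o i := fun i hi => (MF1_inp hL hi).2.2.2.2
  intro t ht
  induction t with
  | zero =>
    refine FregeSystem.IsBlock.append (Scaffold.isBlock_of_forall fun θ hθ => ?_) ?_
    · simp only [consts, List.mem_cons, List.not_mem_nil, or_false] at hθ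
      rcases hθ with rfl | rfl | rfl
      · exact Or.inr (Logic.infer hGL 11 (by decide) (FregeSystem.sub [K, var (VX L o).z]) rfl
          (FregeSystem.prems_cons h.hVX.hV.hz FregeSystem.prems_nil))
      · exact Or.inr (Logic.infer hGL 11 (by decide) (FregeSystem.sub [K, var (VY L o).z]) rfl
          (FregeSystem.prems_cons h.hVY.hV.hz FregeSystem.prems_nil))
      · exact Or.inr (Logic.infer hGL 11 (by decide) (FregeSystem.sub [K, var (VS L o).z]) rfl
          (FregeSystem.prems_cons h.hVS.hV.hz FregeSystem.prems_nil))
    · have hc : ∀ j (hj : j < 3), (consts L o K)[j]'(by simp [consts]; omega) ∈ T ∪ {χ | χ ∈ consts L o K} :=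
        fun j hj => Or.inr (List.getElem_mem _)
      refine (zd L o).isBlock_segs hGK hGL (T := T ∪ {χ | χ ∈ consts L o K}) (hM1.hN₁.mono Set.subset_union_left)
        (Sub.View.Avail.congr (h.hVX.hCA.mono Set.subset_union_left) rfl (fun i hi => rfl) (fun i hi => e1n i hi))
        (fun i hi => ?_) (fun i hi => ?_) (fun i hi => ?_) (Or.inl hx)
      · show ctx K (neg (var (ModAddU.MFI.a (MF1 L o 0) i))) ∈ _; rw [e1a i hi]; exact hc 0 (by omega)
      · show ctx K (neg (var (ModAddU.MFI.b (MF1 L o 0) L i))) ∈ _; rw [e1b i hi]; exact hc 1 (by omega)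
      · exact hc 2 (by omega)
  | succ t ih =>
    refine (ih (by omega)).append (isBlock_segs hG hGM hGR hGN hGA hGL hGG hGK (h.mono Set.subset_union_left) hm (by omega)
      (Or.inl hx) (fun i h₁ h₂ => Or.inl (hn i h₁ h₂)) (fun χ hχ => Or.inl (hrX χ hχ)) (fun χ hχ => Or.inl (hrY χ hχ))
      (fun χ hχ => Or.inl (hhX χ hχ)) (fun χ hχ => Or.inl (hhY χ hχ)) (fun ht0 i hi => ?_) (fun ht0 => ⟨fun i hi => ?_, fun i hi => ?_, fun i hi => ?_⟩))
    · subst ht0; exact Or.inr (mem_ldUpTo_zero hi)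
    · obtain ⟨s, rfl⟩ : ∃ s, t = s + 1 := ⟨t - 1, by omega⟩
      exact Or.inr (mem_ldUpTo_succ hi).1
    · obtain ⟨s, rfl⟩ : ∃ s, t = s + 1 := ⟨t - 1, by omega⟩
      exact Or.inr (mem_ldUpTo_succ hi).2.1
    · obtain ⟨s, rfl⟩ : ∃ s, t = s + 1 := ⟨t - 1, by omega⟩
      exact Or.inr (mem_ldUpTo_succ hi).2.2

/-- **Left distributivity of modular multiplication inside Frege**: for an available occurrence
of the distributivity kit with `x, y < n` (facts about the comparators `CA` of `VX`, `VY`) and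
the high bits of `n` false from position `m` on (`m + 2 ≤ L`), the lines form a block
concluding `P_L(VS) ≡ R(RL)`, i.e. `(x ⊕ y) ⊗ b = (x ⊗ b) ⊕ (y ⊗ b)` bitwise.
[cite: CookReckhow1979, §2; Krajicek1995, §9.2] -/
theorem isBlock_lines (hG : ∀ r ∈ ModAddU.assocRules, r ∈ G.rules) (hGM : ∀ r ∈ ModAddU.rules, r ∈ G.rules)
    (hGR : ∀ r ∈ rangeRules, r ∈ G.rules) (hGN : ∀ r ∈ Netlist.rules, r ∈ G.rules)
    (hGA : ∀ r ∈ Adder.rules, r ∈ G.rules) (hGL : ∀ r ∈ Logic.rules, r ∈ G.rules)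
    (hGG : ∀ r ∈ ModAddU.glueRules, r ∈ G.rules) (hGK : ∀ r ∈ maskRules, r ∈ G.rules)
    (h : LAvail L o K Γ) {m : ℕ} (hm : m + 2 ≤ L)
    (hx : ctx K (neg (var (((VX L o).CA L).ge L L))) ∈ Γ) (hy : ctx K (neg (var (((VY L o).CA L).ge L L))) ∈ Γ)
    (hn : ∀ i, m ≤ i → i < L → ctx K (neg (var (n L o i))) ∈ Γ) : G.IsBlock Γ (lines L o K m) := by
  have hL : 0 < L := by omega
  -- the prefix
  have hP : G.IsBlock Γ (prefixLines L o K m) := by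
    refine (View.isBlock_rangeLines hGR hGM hGA h.hVX hx).append ((View.isBlock_rangeLines hGR hGM hGA
      (h.hVY.mono Set.subset_union_left) (Or.inl hy)).append ((View.isBlock_highAll hGR
      ((h.hVX.mono Set.subset_union_left).mono Set.subset_union_left)
      (fun i h₁ h₂ => Or.inl (Or.inl (hn i h₁ h₂))) (fun χ hχ => Or.inl (Or.inr hχ))).append (View.isBlock_highAll hGR
      (((h.hVY.mono Set.subset_union_left).mono Set.subset_union_left).mono Set.subset_union_left)
      (fun i h₁ h₂ => Or.inl (Or.inl (Or.inl (hn i h₁ h₂)))) (fun χ hχ => Or.inl (Or.inr hχ)))))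
  have pf : ∀ {χ}, χ ∈ prefixLines L o K m → χ ∈ Γ ∪ {χ | χ ∈ prefixLines L o K m} := fun h => Or.inr h
  refine hP.append ((isBlock_ldUpTo hG hGM hGR hGN hGA hGL hGG hGK (h.mono Set.subset_union_left) hm (Or.inl hx)
    (fun i h₁ h₂ => Or.inl (hn i h₁ h₂)) (fun χ hχ => pf (List.mem_append_left _ hχ))
    (fun χ hχ => pf (List.mem_append_right _ (List.mem_append_left _ hχ)))
    (fun χ hχ => pf (List.mem_append_right _ (List.mem_append_right _ (List.mem_append_left _ hχ))))
    (fun χ hχ => pf (List.mem_append_right _ (List.mem_append_right _ (List.mem_append_right _ hχ)))) L le_rfl).append ?_)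
  -- the final link
  obtain ⟨L', rfl⟩ : ∃ L', L = L' + 1 := ⟨L - 1, by omega⟩
  have hM2 : ModAddU.MFI.MAvail (MF2 (L' + 1) o L') (L' + 1) K Γ := ModAddU.MFI.avail_ofOcc (h.hMF2 L' (by omega))
  have e2n : ∀ i < L' + 1, ModAddU.MFI.n (MF2 (L' + 1) o L') (L' + 1) i = n (L' + 1) o i :=
    fun i hi => (MF2_inp (by omega) hi).2.2.2.2
  have up : ∀ {χ}, χ ∈ ldUpTo (L' + 1) o K m (L' + 1) →
      χ ∈ Γ ∪ {χ | χ ∈ prefixLines (L' + 1) o K m} ∪ {χ | χ ∈ ldUpTo (L' + 1) o K m (L' + 1)} := fun h => Or.inr h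
  have hΓ : Γ ⊆ Γ ∪ {χ | χ ∈ prefixLines (L' + 1) o K m} ∪ {χ | χ ∈ ldUpTo (L' + 1) o K m (L' + 1)} :=
    fun _ h => Or.inl (Or.inl h)
  refine ((⟨N26 (L' + 1) o L', RL (L' + 1) o, L' + 1⟩ : ModAddU.PairData).isBlock_leibLines hGN hGL (hM2.hN₆.mono hΓ)
    (h.hRL.mono hΓ) (fun i hi => ?_) (fun i hi => ?_) (fun i hi => ?_)).append (ModAddU.MFI.isBlock_transLines hGL K
    (v := (N26 (L' + 1) o L').R (L' + 1)) (fun i hi => ?_) fun i hi => ?_)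
  · exact up (mem_ldUpTo_succ hi).2.1
  · exact up (mem_ldUpTo_succ hi).2.2
  · show ctx K (eqv (ModAddU.MFI.n (MF2 (L' + 1) o L') (L' + 1) i) (n (L' + 1) o i)) ∈ _
    rw [e2n i hi]; exact up (mem_ldUpTo_refl hi)
  · exact Or.inl (up (mem_ldUpTo_succ hi).1)
  · exact Or.inr ((⟨N26 (L' + 1) o L', RL (L' + 1) o, L' + 1⟩ : ModAddU.PairData).mem_leibLines hi)

/-- **The conclusion of the distributivity law**: `P_L(VS)ᵢ ↔ R(RL)ᵢ` for `i < L`. [folklore] -/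
theorem mem_lines {m i : ℕ} (hi : i < L) : ctx K (eqv ((VS L o).P L L i) ((RL L o).R L i)) ∈ lines L o K m :=
  List.mem_append_right _ (List.mem_append_right _ (List.mem_append_right _ (Netlist.mem_map_range hi)))

/-! ### The size of the law -/

/-- A flattened list of uniformly short segments is short. [folklore] -/
theorem length_flatten_le {α : Type} {l : List (List α)} {c : ℕ} (h : ∀ D ∈ l, D.length ≤ c) :
    l.flatten.length ≤ l.length * c := by
  induction l with
  | nil => simp
  | cons D l ih =>
    rw [List.flatten_cons, List.length_append, List.length_cons, Nat.succ_mul]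
    have := h D (by simp)
    have := ih fun D' hD' => h D' (by simp [hD'])
    omega

/-- **Every line of a stage has size `≤ |K| + 153`.** [folklore] -/
theorem bounded_segs (L : ℕ) (o : Occ) (K : PropForm ℕ) (m t : ℕ) : ModAddU.Bounded (K.size + 153) (segs L o K m t).flatten := by
  refine ModAddU.Bounded.flatten fun D hD => ?_
  simp only [segs, linkSegs, List.cons_append, List.nil_append, List.mem_cons, List.not_mem_nil, or_false] at hD
  rcases hD with rfl | rfl | rfl | rfl | rfl | rfl | rfl | rfl | rfl | rfl | rfl | rfl | rfl | rfl | rfl | rfl | rfl | rfl |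
    rfl | rfl | rfl | rfl | rfl | rfl | rfl | rfl
  · exact ModAddU.bounded_refl _ _ (by omega)
  · split_ifs
    · exact fun θ h => by simp at h
    · exact (ModAddU.MFI.bounded_pair _ _ (by omega)).1
  · split_ifs
    · exact fun θ h => by simp at h
    · exact ModAddU.bounded_ctx_eqv _ (by omega) _ _ _
  iterate 4 · exact ModAddU.MFI.bounded_transfer _ _ _ _ (by omega)
  · exact ModAddU.MFI.bounded_lines _ _ _ _
  · exact (ModAddU.MFI.bounded_pair _ _ (by omega)).1
  · exact ModAddU.bounded_ctx_eqv _ (by omega) _ _ _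
  iterate 4 · exact (ModAddU.MFI.bounded_pair _ _ (by omega)).1
  · exact ((md L o t).bounded_maskLines K).mono (by omega)
  · exact ModAddU.bounded_ctx_eqv _ (by omega) _ _ _
  · exact ModAddU.bounded_ctx_eqv _ (by omega) _ _ _
  · exact (ModAddU.MFI.bounded_pair _ _ (by omega)).1
  iterate 4 · exact ModAddU.MFI.bounded_transfer _ _ _ _ (by omega)
  · exact ModAddU.MFI.bounded_lines _ _ _ _
  · exact (ModAddU.MFI.bounded_pair _ _ (by omega)).1
  · exact (ModAddU.MFI.bounded_pair _ _ (by omega)).1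
  · exact ModAddU.bounded_ctx_eqv _ (by omega) _ _ _

/-- Length of a congruence block. [folklore] -/
theorem length_leibLines (d : ModAddU.PairData) (K : PropForm ℕ) : (d.leibLines K).length = 6 * d.L + 2 := by
  simp only [ModAddU.PairData.leibLines, ModAddU.PairData.tail, Adder.leibLines, Sub.leibLines, List.length_append,
    List.length_map, List.length_range]
  ring

/-- Length of a transfer block. [folklore] -/
theorem length_transferLines (A' A : Sub.View) (K : PropForm ℕ) (L : ℕ) :
    (ModAddU.AssocKit.transferLines A' A K L).length = 5 * L + 2 := by
  simp only [ModAddU.AssocKit.transferLines, Adder.reflLines, Sub.leibLines, Adder.leibLines, List.length_append,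
    List.length_map, List.length_range, List.length_singleton]
  ring

/-- **A stage has at most `26 · (460L + 310)` lines.** [folklore] -/
theorem length_segs_flatten_le (L : ℕ) (o : Occ) (K : PropForm ℕ) (m t : ℕ) :
    (segs L o K m t).flatten.length ≤ 26 * (460 * L + 310) := by
  rw [← length_segs L o K m t]
  refine length_flatten_le fun D hD => ?_
  have hmd : (md L o t).L = L := rfl
  simp only [segs, linkSegs, List.cons_append, List.nil_append, List.mem_cons, List.not_mem_nil, or_false] at hD
  rcases hD with rfl | rfl | rfl | rfl | rfl | rfl | rfl | rfl | rfl | rfl | rfl | rfl | rfl | rfl | rfl | rfl | rfl | rfl |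
    rfl | rfl | rfl | rfl | rfl | rfl | rfl | rfl
  · simp [Adder.reflLines]; omega
  · split_ifs
    · simp
    · rw [length_leibLines]; dsimp only; omega
  · split_ifs
    · simp
    · simp [ModAddU.MFI.transLines]; omega
  iterate 4 · rw [length_transferLines]; omega
  · exact ModAddU.MFI.length_lines_le _ _ _ _
  · rw [length_leibLines]; dsimp only; omega
  · simp [ModAddU.MFI.transLines]; omega
  iterate 4 · rw [length_leibLines]; dsimp only; omega
  · rw [(md L o t).length_maskLines K, hmd]; omega
  · simp [ModAddU.MFI.transLines]; omega
  · simp [ModAddU.MFI.transLines]; omega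
  · rw [length_leibLines]; dsimp only; omega
  iterate 4 · rw [length_transferLines]; omega
  · exact ModAddU.MFI.length_lines_le _ _ _ _
  · rw [length_leibLines]; dsimp only; omega
  · rw [length_leibLines]; dsimp only; omega
  · simp [ModAddU.MFI.transLines]; omega

/-- Size of a stage. [folklore] -/
theorem proofSize_segs (L : ℕ) (o : Occ) (K : PropForm ℕ) (m t : ℕ) :
    proofSize (segs L o K m t).flatten ≤ 26 * (460 * L + 310) * (K.size + 153) :=
  (bounded_segs L o K m t).proofSize_le.trans (Nat.mul_le_mul_right _ (length_segs_flatten_le L o K m t))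

/-- Size of the stages. [folklore] -/
theorem proofSize_ldUpTo (L : ℕ) (o : Occ) (K : PropForm ℕ) (m : ℕ) :
    ∀ t, proofSize (ldUpTo L o K m t) ≤ (4 * L + 5) * (K.size + 12) + t * (26 * (460 * L + 310) * (K.size + 153)) := by
  intro t
  induction t with
  | zero =>
    have hz : (zd L o).L = L := rfl
    have h0 : proofSize (consts L o K) ≤ 3 * (K.size + 12) := by
      refine (ModAddU.Bounded.proofSize_le (B := K.size + 12) fun θ hθ => ?_).trans (by simp [consts])
      simp only [consts, List.mem_cons, List.not_mem_nil, or_false] at hθ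
      rcases hθ with rfl | rfl | rfl <;> (rw [ModAddU.size_ctx]; simp [size])
    have h1 := ((zd L o).bounded_segs K).proofSize_le
    rw [(zd L o).length_segs K, hz] at h1
    rw [ldUpTo, proofSize_append]; nlinarith
  | succ t ih =>
    rw [ldUpTo, proofSize_append]
    calc _ ≤ (4 * L + 5) * (K.size + 12) + t * (26 * (460 * L + 310) * (K.size + 153)) + 26 * (460 * L + 310) * (K.size + 153) :=
          Nat.add_le_add ih (proofSize_segs L o K m t)
      _ = _ := by ring

/-- **Size of the distributivity law**: `≤ 12000 (L+1)² (|K| + 153)` symbols. [folklore] -/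
theorem proofSize_lines (L : ℕ) (o : Occ) (K : PropForm ℕ) (m : ℕ) :
    proofSize (lines L o K m) ≤ 12000 * ((L + 1) * (L + 1)) * (K.size + 153) := by
  have hP : proofSize (prefixLines L o K m) ≤
      2 * ((L + 2) * (K.size + 10) + L * ((3 * L + 8) * (K.size + 153))) + 2 * ((3 * L + 1) * (2 * L * (K.size + 3))) := by
    simp only [prefixLines, proofSize_append]
    have h1 := View.proofSize_rangeLines (V := VX L o) (L := L) (K := K)
    have h2 := View.proofSize_rangeLines (V := VY L o) (L := L) (K := K)
    have h3 := View.proofSize_highAll (V := VX L o) (L := L) (K := K) m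
    have h4 := View.proofSize_highAll (V := VY L o) (L := L) (K := K) m
    omega
  have hU := proofSize_ldUpTo L o K m L
  have hF : proofSize (finalLines L o K) ≤ (6 * L + 2) * (K.size + 10) + L * (K.size + 10) := by
    rw [finalLines, proofSize_append]
    refine Nat.add_le_add (ModAddU.PairData.proofSize_leibLines _) ?_
    refine ((ModAddU.bounded_ctx_eqv K le_rfl _ _ _).proofSize_le).trans ?_
    simp
  rw [lines, proofSize_append, proofSize_append]
  nlinarith [hP, hU, hF, Nat.zero_le L, Nat.zero_le K.size]

/-- **The distributivity law in compositional form.** [cite: CookReckhow1979, §2; Krajicek1995, §9.2] -/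
theorem yields (hG : ∀ r ∈ ModAddU.assocRules, r ∈ G.rules) (hGM : ∀ r ∈ ModAddU.rules, r ∈ G.rules)
    (hGR : ∀ r ∈ rangeRules, r ∈ G.rules) (hGN : ∀ r ∈ Netlist.rules, r ∈ G.rules)
    (hGA : ∀ r ∈ Adder.rules, r ∈ G.rules) (hGL : ∀ r ∈ Logic.rules, r ∈ G.rules)
    (hGG : ∀ r ∈ ModAddU.glueRules, r ∈ G.rules) (hGK : ∀ r ∈ maskRules, r ∈ G.rules)
    (h : LAvail L o K Γ) {m : ℕ} (hm : m + 2 ≤ L)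
    (hx : ctx K (neg (var (((VX L o).CA L).ge L L))) ∈ Γ) (hy : ctx K (neg (var (((VY L o).CA L).ge L L))) ∈ Γ)
    (hn : ∀ i, m ≤ i → i < L → ctx K (neg (var (n L o i))) ∈ Γ) :
    G.Yields Γ (ctxSet K (eqW ((VS L o).P L L) ((RL L o).R L) L)) (12000 * ((L + 1) * (L + 1)) * (K.size + 153)) := by
  refine Yields.of_isBlock (isBlock_lines hG hGM hGR hGN hGA hGL hGG hGK h hm hx hy hn) ?_ (proofSize_lines L o K m)
  rintro θ ⟨Lb, hLb, rfl⟩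
  obtain ⟨i, hi, rfl⟩ := List.mem_map.1 hLb
  exact mem_lines (List.mem_range.1 hi)

end LD

end ModMulU

end Literature.Computability.MetaComplexity
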